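import Literature.NumberTheory.Transcendental.LinGroupJetArithmetic
import Literature.NumberTheory.Transcendental.UniversalAuxiliaryFunction
import Literature.NumberTheory.Transcendental.MixedDerivativeBounds
import Literature.NumberTheory.Transcendental.LinearSubgroupTheoremAssembly
import HarnessLib

/-!
# The auxiliary function of the Linear Subgroup Theorem on `𝔾ₐ^{d₀} × 𝔾ₘ^{d₁}` (Waldschmidt 1988, Prop. 6.1)

Topic `Literature/NumberTheory/Transcendental`. Everything here is PROVED (no definitions, no named
facts). This file discharges the hypothesis `hAF` of
`Literature.NumberTheory.Transcendental.LinGroup.weakObstruction_of_zeroEstimate_of_auxiliary`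
(`LinearSubgroupTheoremAssembly.lean`): the auxiliary function of
[Waldschmidt1988, §6 Proposition 6.1] for the linear group `G = 𝔾ₐ^{d₀} × 𝔾ₘ^{d₁}` in the
period-free case (`a = 1`, `b = 2`, `κ = 0`, `d₂ = 0`), which is one of the two results
(with Philippon's zero estimate) behind the named fact
`Literature.Barriers.Schanuel.roy1992_thm1` (= [Waldschmidt1988, Thm 4.1] for this group).
In print Proposition 6.1 "is proved in [15] Proposition 2.4" ([Waldschmidt1983], Schwarz lemma +
interpolation determinants are NOT used: we follow the interpolation-free "fonction auxiliaire
générale" of [Waldschmidt1981, §3], box principle on the Taylor coefficients, as the tree already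
does for pure exponential polynomials in `SixExponentialsSeveralVariablesAuxiliary.lean`).

## The statement proved (`LinGroup.auxiliaryFunction`)

Let `V ⊊ Lie G = ℂ^{d₀} × ℂ^{d₁}`, `n = dim V < d = d₀ + d₁`, `W ⊆ V` contained in the span of
finitely many `w_k ∈ W` with algebraic coordinates, `y₁, …, y_m ∈ V` with `y_{j,0,i} ∈ ℚ̄` and
`e^{y_{j,1,l}} ∈ ℚ̄`. Then there is `C ≥ 1` such that for every large `S ∈ ℕ`, with
`Δ^{d−n} = C S^{d₁} (log S)^{2d₀}` (`LinGroup.auxDelta`), there are a polynomial `P ≠ 0` with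
`deg_X P ≤ Δ/(log S)²`, `deg_Y P ≤ Δ/S`, and `T ≥ Δ/log S`, such that `P ∘ exp_G` vanishes to
order `≥ T` along `W` (`LinGroup.VanishesToOrder`) at every `exp_G(h₁y₁ + ⋯ + h_my_m)`,
`0 ≤ hⱼ ≤ S`.

## The proof (pp. 389 of [Waldschmidt1988], §§3–4 of [Waldschmidt1981])

* `evalAt_auxP_exp_lin` — restricted to `V = ⊕ ℂv_m` and rescaled by `R ≈ S`, the monomials
  `X^a Y^b ∘ exp_G` are `Q_λ(ζ') e^{⟨c_λ, ζ'⟩}` with polynomial prefactors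
  `Q_λ = ∏ᵢ (∑_m R v_{m,0,i} ζ'_m)^{aᵢ}` (`‖Q_λ‖₁ ≤ (R c_v)^{|a|}`, `l1Norm_prefactor_le`) and
  frequencies `|c_{λ,m}| ≤ R |b| c_v` (`norm_freq_le`);
* `exists_auxP_small` — the universal auxiliary function `exists_small_universal`
  (`UniversalAuxiliaryFunction.lean`, box principle) gives `P = ∑ p_λ X^{a_λ}Y^{b_λ}`
  (`LinGroup.auxP`) with `|p_λ| ≤ e^Δ` and `|P(exp_G x)| ≤ ε` for `x ∈ V`, `‖x‖_v ≤ R`;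
* `norm_wordDeriv_le_of_small` — the mixed jets of `x ↦ P(exp_G x)` along `W` at `y_h` are the
  values of words of invariant derivations (`iteratedFDeriv_evalAt_mul_exp_apply`,
  `LinGroupDerivations.lean`) and are `≤ 2^k k^k ε` by polarisation + Cauchy
  (`norm_iteratedFDeriv_apply_le_of_small`, `MixedDerivativeBounds.lean`);
* `intPolyBound_coord_exp_latt`, `vanishesToOrder_auxP_of_small` — `k! ×` these values are
  integer polynomials in the algebraic data (`intPolyBound_factorial_mul_wordDeriv_auxP`,
  `LinGroupJetArithmetic.lean`) of degree `O(Δ)` and length `e^{O(Δ)}`, so Liouville's inequality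
  (`IntPolyBound.eq_zero_of_norm_lt`, `IntPolyBounds.lean`) makes them vanish, whence the
  vanishing along `W` (`vanishesToOrder_of_span_words`);
* `auxDelta_facts`, `C_mul_pow_le_card`, `count_lt`, `factorial_mul_le_exp`, `eps_le_exp_neg`,
  `exp_neg_le_threshold`, `length_le_exp` — the bookkeeping of the parameters
  (`T = ⌈Δ/L⌉`, `E₀ − 1 = ⌊Δ/(d₀L²)⌋`, `E₁ − 1 = ⌊Δ/(d₁S)⌋`, `#Λ = E₀^{d₀}E₁^{d₁} ≥ CΔⁿ/(d₀^{d₀}d₁^{d₁})`,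
  truncation order and box size `≍ Δ`, `≍ e^{O(Δ)}`), all constants being explicit in the data and
  `C` chosen last;
* `auxiliaryFunction` — the assembly.

## References

* [Waldschmidt1988] M. Waldschmidt, *On the transcendence methods of Gel'fond and Schneider in
  several variables*, New Advances in Transcendence Theory (A. Baker ed.), CUP 1988, 375–398,
  §6 Proposition 6.1, §7 (pp. 389–390).
* [Waldschmidt1981] M. Waldschmidt, *Transcendance et exponentielles en plusieurs variables*,
  Invent. Math. 63 (1981) 97–127, §3 Théorème 3.1, §4 Corollaire 4.2 (pp. 100–105).
* [Waldschmidt1983] M. Waldschmidt, *Sous-groupes analytiques de groupes algébriques*, Ann. of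
  Math. 117 (1983) 627–657, Proposition 2.4 (cited by [Waldschmidt1988]; not held).
-/

noncomputable section

open MvPolynomial Finset Complex
open scoped ContDiff

namespace Literature.NumberTheory.Transcendental

namespace LinGroup

open Nesterenko

section Bridge

variable {d₀ d₁ E₀ E₁ n : ℕ}

/-- **`P_p` at a point of `exp_G`**:
`P_p(exp_G w) = ∑_λ p_λ (∏ᵢ w₀ᵢ^{aᵢ}) e^{∑ₗ bₗ w₁ₗ}`. [folklore] -/
theorem evalAt_auxP_exp (p : (Fin d₀ → Fin E₀) × (Fin d₁ → Fin E₁) → ℤ)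
    (w : (Fin d₀ → ℂ) × (Fin d₁ → ℂ)) :
    evalAt (auxP p) (exp w) = ∑ lam, (p lam : ℂ) *
      ((∏ i, w.1 i ^ (lam.1 i : ℕ)) * cexp (∑ l, ((lam.2 l : ℕ) : ℂ) * w.2 l)) := by
  classical
  rw [auxP, evalAt, map_sum]
  refine Finset.sum_congr rfl fun lam _ => ?_
  rw [smul_eval, eval_monomial, one_mul, Finsupp.prod_fintype _ _ (fun v => pow_zero _),
    Fintype.prod_sum_type]
  have h1 : (∏ i, coord (exp w) (Sum.inl i) ^ expnt lam (Sum.inl i)) = ∏ i, w.1 i ^ (lam.1 i : ℕ) :=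
    Finset.prod_congr rfl fun i _ => by rw [coord_inl, toAdd_exp_fst, expnt_inl]
  have h2 : (∏ l, coord (exp w) (Sum.inr l) ^ expnt lam (Sum.inr l)) =
      cexp (∑ l, ((lam.2 l : ℕ) : ℂ) * w.2 l) := by
    rw [Complex.exp_sum]
    exact Finset.prod_congr rfl fun l _ => by
      rw [coord_inr, coe_exp_snd, expnt_inr, Complex.exp_nat_mul]
  rw [h1, h2]

/-- **The bridge**: along `ζ' ↦ exp_G(∑_m R ζ'_m v_m)` the auxiliary polynomial is the
exponential-polynomial `∑_λ p_λ Q_λ(ζ') e^{⟨c_λ, ζ'⟩}` of `exists_small_universal`, with the scaled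
prefactors `Q_λ(ζ') = ∏ᵢ (∑_m R v_{m,0,i} ζ'_m)^{aᵢ}` and frequencies `c_{λ,m} = R ∑ₗ bₗ v_{m,1,l}`.
[folklore] -/
theorem evalAt_auxP_exp_lin (p : (Fin d₀ → Fin E₀) × (Fin d₁ → Fin E₁) → ℤ) (R : ℝ)
    (v : Fin n → (Fin d₀ → ℂ) × (Fin d₁ → ℂ)) (ζ : Fin n → ℂ) :
    evalAt (auxP p) (exp (∑ m, ((R : ℂ) * ζ m) • v m)) = ∑ lam, (p lam : ℂ) *
      (MvPolynomial.eval ζ (∏ i, (∑ m, C ((R : ℂ) * (v m).1 i) * X m) ^ (lam.1 i : ℕ) : MvPolynomial (Fin n) ℂ) *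
        cexp (∑ m, ((R : ℂ) * ∑ l, ((lam.2 l : ℕ) : ℂ) * (v m).2 l) * ζ m)) := by
  rw [evalAt_auxP_exp]
  refine Finset.sum_congr rfl fun lam _ => ?_
  congr 2
  · rw [map_prod]
    refine Finset.prod_congr rfl fun i _ => ?_
    rw [map_pow, map_sum]
    congr 1
    rw [Prod.fst_sum, Finset.sum_apply]
    refine Finset.sum_congr rfl fun m _ => ?_
    simp only [Prod.smul_fst, Pi.smul_apply, smul_eq_mul, map_mul, eval_C, eval_X]
    ring
  · congr 1
    simp only [Prod.snd_sum, Finset.sum_apply, Prod.smul_snd, Pi.smul_apply, smul_eq_mul,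
      Finset.mul_sum]
    rw [Finset.sum_comm]
    exact Finset.sum_congr rfl fun m _ => by
      rw [Finset.sum_mul]
      exact Finset.sum_congr rfl fun l _ => by ring

/-- `‖Q_λ‖₁ ≤ (R c_A)^{∑ aᵢ}` when `∑_m ‖v_{m,0,i}‖ ≤ c_A`. [folklore] -/
theorem l1Norm_prefactor_le {R cA : ℝ} (hR : 0 ≤ R) (v : Fin n → (Fin d₀ → ℂ) × (Fin d₁ → ℂ))
    (hcA : ∀ i, ∑ m, ‖(v m).1 i‖ ≤ cA) (lam : (Fin d₀ → Fin E₀) × (Fin d₁ → Fin E₁)) :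
    l1Norm (∏ i, (∑ m, C ((R : ℂ) * (v m).1 i) * X m) ^ (lam.1 i : ℕ) : MvPolynomial (Fin n) ℂ) ≤
      (R * cA) ^ ∑ i, (lam.1 i : ℕ) := by
  classical
  rw [← Finset.prod_pow_eq_pow_sum]
  refine (l1Norm_prod_le _ _).trans (Finset.prod_le_prod (fun _ _ => l1Norm_nonneg _) fun i _ => ?_)
  refine (l1Norm_pow_le _ _).trans (pow_le_pow_left₀ (l1Norm_nonneg _) ?_ _)
  refine (l1Norm_sum_le _ _).trans ?_
  calc ∑ m, l1Norm (C ((R : ℂ) * (v m).1 i) * X m) ≤ ∑ m, R * ‖(v m).1 i‖ := by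
        refine Finset.sum_le_sum fun m _ => ?_
        calc l1Norm (C ((R : ℂ) * (v m).1 i) * X m) ≤ l1Norm (C ((R : ℂ) * (v m).1 i)) * l1Norm (X m) :=
              l1Norm_mul_le _ _
          _ ≤ ‖(R : ℂ) * (v m).1 i‖ * 1 :=
              mul_le_mul (l1Norm_C _).le (l1Norm_X _).le (l1Norm_nonneg _) (norm_nonneg _)
          _ = R * ‖(v m).1 i‖ := by rw [mul_one, norm_mul, Complex.norm_real, Real.norm_of_nonneg hR]
    _ = R * ∑ m, ‖(v m).1 i‖ := by rw [Finset.mul_sum]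
    _ ≤ R * cA := mul_le_mul_of_nonneg_left (hcA i) hR

/-- `deg_{ζ'_m} Q_λ ≤ ∑ aᵢ`. [folklore] -/
theorem degreeOf_prefactor_le (R : ℝ) (v : Fin n → (Fin d₀ → ℂ) × (Fin d₁ → ℂ))
    (lam : (Fin d₀ → Fin E₀) × (Fin d₁ → Fin E₁)) (m : Fin n) :
    (∏ i, (∑ m', C ((R : ℂ) * (v m').1 i) * X m') ^ (lam.1 i : ℕ) : MvPolynomial (Fin n) ℂ).degreeOf m ≤
      ∑ i, (lam.1 i : ℕ) := by
  classical
  refine (degreeOf_prod_le _ _ _).trans (Finset.sum_le_sum fun i _ => ?_)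
  refine (degreeOf_pow_le _ _ _).trans ?_
  have hlin : ((∑ m', C ((R : ℂ) * (v m').1 i) * X m' : MvPolynomial (Fin n) ℂ)).degreeOf m ≤ 1 := by
    refine (degreeOf_sum_le _ _ _).trans (Finset.sup_le fun m' _ => ?_)
    refine (degreeOf_C_mul_le _ _ _).trans ?_
    by_cases hm : m = m'
    · subst hm; rw [degreeOf_X_self]
    · rw [degreeOf_X_of_ne hm]; exact Nat.zero_le _
  calc (lam.1 i : ℕ) * ((∑ m', C ((R : ℂ) * (v m').1 i) * X m' : MvPolynomial (Fin n) ℂ)).degreeOf m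
      ≤ (lam.1 i : ℕ) * 1 := Nat.mul_le_mul_left _ hlin
    _ = (lam.1 i : ℕ) := mul_one _

/-- `‖c_{λ,m}‖ ≤ R (∑ bₗ) c_B` when `‖v_{m,1,l}‖ ≤ c_B`. [folklore] -/
theorem norm_freq_le {R cB : ℝ} (hR : 0 ≤ R) (v : Fin n → (Fin d₀ → ℂ) × (Fin d₁ → ℂ))
    (hv : ∀ m l, ‖(v m).2 l‖ ≤ cB) (lam : (Fin d₀ → Fin E₀) × (Fin d₁ → Fin E₁)) (m : Fin n) :
    ‖((R : ℂ) * ∑ l, ((lam.2 l : ℕ) : ℂ) * (v m).2 l)‖ ≤ R * ((∑ l, (lam.2 l : ℕ) : ℕ) * cB) := by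
  rw [norm_mul, Complex.norm_real, Real.norm_of_nonneg hR]
  refine mul_le_mul_of_nonneg_left ?_ hR
  refine (norm_sum_le _ _).trans ?_
  push_cast
  rw [Finset.sum_mul]
  refine Finset.sum_le_sum fun l _ => ?_
  rw [norm_mul, Complex.norm_natCast]
  exact mul_le_mul_of_nonneg_left (hv m l) (Nat.cast_nonneg _)

end Bridge

/-! ### Assembly lemmas: smallness on a ball of `V`, smallness of the words, integrality of the points -/

section Pieces

variable {d₀ d₁ n : ℕ}

/-- **Smallness of `P_p ∘ exp_G` on a ball of `V`** (the universal auxiliary function, rescaled):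
with `V = ⊕ ℂ v_m`, `∑_m ‖v_{m,0,i}‖ ≤ c_v`, `‖v_{m,1,l}‖ ≤ c_v`, there are integers `p_λ`, not all
zero, `|p_λ| ≤ P_b`, with `|P_p(exp_G(∑ ξ_m v_m))|` small for `‖ξ_m‖ ≤ R`.
[cite: Waldschmidt1988, §6 Proposition 6.1 (p. 389)] -/
theorem exists_auxP_small (v : Fin n → (Fin d₀ → ℂ) × (Fin d₁ → ℂ)) {E₀ E₁ : ℕ} {R c_v : ℝ}
    (hR : 1 ≤ R) (hc_v : 1 ≤ c_v) (hvA : ∀ i, ∑ m, ‖(v m).1 i‖ ≤ c_v)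
    (hvB : ∀ m l, ‖(v m).2 l‖ ≤ c_v) (Ttr Pb kb : ℕ)
    (hT8 : 8 * (R * ((d₁ * (E₁ - 1) : ℕ) : ℝ) * c_v) ≤ Ttr) (hT1 : 1 ≤ Ttr) (hkb : 0 < kb)
    (hcard : kb ^ (2 * (d₀ * (E₀ - 1) + 1 + Ttr) ^ n) < (Pb + 1) ^ (E₀ ^ d₀ * E₁ ^ d₁)) :
    ∃ p : (Fin d₀ → Fin E₀) × (Fin d₁ → Fin E₁) → ℤ, p ≠ 0 ∧ (∀ lam, |p lam| ≤ Pb) ∧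
      ∀ ξ : Fin n → ℂ, (∀ m, ‖ξ m‖ ≤ R) →
        ‖evalAt (auxP p) (exp (∑ m, ξ m • v m))‖ ≤
          ((d₀ * (E₀ - 1) + 1 + Ttr : ℕ) : ℝ) ^ n *
              (2 * ((2 * ((E₀ ^ d₀ * E₁ ^ d₁ : ℕ) : ℝ) *
                ((R * c_v) ^ (d₀ * (E₀ - 1)) *
                  Real.exp (R * ((d₁ * (E₁ - 1) : ℕ) : ℝ) * c_v) ^ n) * Pb + 1) / kb)) +
            ((E₀ ^ d₀ * E₁ ^ d₁ : ℕ) : ℝ) * Pb * ((R * c_v) ^ (d₀ * (E₀ - 1)) *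
              (n * Real.exp (R * ((d₁ * (E₁ - 1) : ℕ) : ℝ) * c_v) ^ n * (2 * Real.exp (-Ttr)))) := by
  classical
  have hR0 : 0 ≤ R := zero_le_one.trans hR
  have hRc : 1 ≤ R * c_v := one_le_mul_of_one_le_of_one_le hR hc_v
  have hcardΛ : Fintype.card ((Fin d₀ → Fin E₀) × (Fin d₁ → Fin E₁)) = E₀ ^ d₀ * E₁ ^ d₁ := by
    simp [Fintype.card_prod, Fintype.card_fin]
  have hsumA : ∀ lam : (Fin d₀ → Fin E₀) × (Fin d₁ → Fin E₁), ∑ i, (lam.1 i : ℕ) ≤ d₀ * (E₀ - 1) :=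
    fun lam => calc ∑ i, (lam.1 i : ℕ) ≤ ∑ _i : Fin d₀, (E₀ - 1) :=
          Finset.sum_le_sum fun i _ => by have := (lam.1 i).2; omega
      _ = d₀ * (E₀ - 1) := by simp
  have hsumB : ∀ lam : (Fin d₀ → Fin E₀) × (Fin d₁ → Fin E₁), ∑ l, (lam.2 l : ℕ) ≤ d₁ * (E₁ - 1) :=
    fun lam => calc ∑ l, (lam.2 l : ℕ) ≤ ∑ _l : Fin d₁, (E₁ - 1) :=
          Finset.sum_le_sum fun l _ => by have := (lam.2 l).2; omega
      _ = d₁ * (E₁ - 1) := by simp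
  obtain ⟨p, hp0, hpb, hsmall⟩ := exists_small_universal
    (fun lam : (Fin d₀ → Fin E₀) × (Fin d₁ → Fin E₁) =>
      (∏ i, (∑ m, C ((R : ℂ) * (v m).1 i) * X m) ^ (lam.1 i : ℕ) : MvPolynomial (Fin n) ℂ))
    (fun (lam : (Fin d₀ → Fin E₀) × (Fin d₁ → Fin E₁)) m => (R : ℂ) * ∑ l, ((lam.2 l : ℕ) : ℂ) * (v m).2 l)
    (E := d₀ * (E₀ - 1) + 1) (T := Ttr) (G₀ := (R * c_v) ^ (d₀ * (E₀ - 1)))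
    (ρ := R * ((d₁ * (E₁ - 1) : ℕ) : ℝ) * c_v) (by positivity) (by positivity)
    (fun lam => (l1Norm_prefactor_le hR0 v hvA lam).trans (pow_le_pow_right₀ hRc (hsumA lam)))
    (fun lam m' => Nat.lt_succ_of_le ((degreeOf_prefactor_le R v lam m').trans (hsumA lam)))
    (fun lam m' => (norm_freq_le hR0 v hvB lam m').trans (by
      rw [mul_assoc]
      refine mul_le_mul_of_nonneg_left (mul_le_mul_of_nonneg_right ?_ (zero_le_one.trans hc_v)) hR0
      exact_mod_cast hsumB lam))
    hT8 (by exact_mod_cast hT1) Pb kb hkb (by rwa [hcardΛ])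
  refine ⟨p, hp0, hpb, fun ξ hξ => ?_⟩
  have hRne : (R : ℂ) ≠ 0 := by exact_mod_cast (zero_lt_one.trans_le hR).ne'
  have hpt : (∑ m, ξ m • v m) = ∑ m, ((R : ℂ) * (ξ m / R)) • v m :=
    Finset.sum_congr rfl fun m _ => by rw [mul_div_cancel₀ _ hRne]
  rw [hpt, evalAt_auxP_exp_lin]
  have h := hsmall (fun m => ξ m / R) fun m => by
    rw [norm_div, Complex.norm_real, Real.norm_of_nonneg hR0]
    exact div_le_one_of_le₀ (hξ m) hR0
  rw [hcardΛ] at h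
  exact h

/-- **Smallness of the words from smallness on a ball**: if `|P(exp_G(∑ ξ_m v_m))| ≤ ε` for
`‖ξ_m‖ ≤ R`, then at `exp_G(∑ ξ⁰_m v_m)`, `‖ξ⁰_m‖ ≤ R₀`, every word of length `k` in letters
`∑_m ω_{j,m} v_m`, `‖ω_{j,m}‖ ≤ c_ω`, `R₀ + c_ω ≤ R`, has value `≤ 2^k k^k ε` (mixed jets are the
values of the words, `iteratedFDeriv_evalAt_mul_exp_apply`; polarisation + Cauchy,
`norm_iteratedFDeriv_apply_le_of_small`). [folklore] -/
theorem norm_wordDeriv_le_of_small (P : MvPolynomial (Fin d₀ ⊕ Fin d₁) ℂ)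
    (v : Fin n → (Fin d₀ → ℂ) × (Fin d₁ → ℂ)) {R R₀ c_om ε : ℝ} (hc_om : 0 ≤ c_om)
    (ξ₀ : Fin n → ℂ) (hξ₀ : ∀ m, ‖ξ₀ m‖ ≤ R₀)
    {J : Type*} (om : J → Fin n → ℂ) (hom : ∀ j m, ‖om j m‖ ≤ c_om) (hR : R₀ + c_om ≤ R)
    (hsmall : ∀ ξ : Fin n → ℂ, (∀ m, ‖ξ m‖ ≤ R) → ‖evalAt P (exp (∑ m, ξ m • v m))‖ ≤ ε)
    {k : ℕ} (κ : Fin k → J) :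
    ‖evalAt (wordDeriv (fun i => ∑ m, om (κ i) m • v m) P) (exp (∑ m, ξ₀ m • v m))‖ ≤
      2 ^ k * (k : ℝ) ^ k * ε := by
  have hf := contDiff_evalAt_mul_exp P (1 : LinGroup d₀ d₁) (n := ω)
  have key := norm_iteratedFDeriv_apply_le_of_small hf (∑ m, ξ₀ m • v m)
    (fun i => ∑ m, om (κ i) m • v m) (ε := ε) ?_
  · rwa [iteratedFDeriv_evalAt_mul_exp_apply, one_mul] at key
  intro S' t ht
  have h1 : (∑ i ∈ S', ∑ m, om (κ i) m • v m) = ∑ m, (∑ i ∈ S', om (κ i) m) • v m := by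
    rw [Finset.sum_comm]
    exact Finset.sum_congr rfl fun m _ => Finset.sum_smul.symm
  have hpt : (∑ m, ξ₀ m • v m) + t • (((k : ℂ))⁻¹ • ∑ i ∈ S', ∑ m, om (κ i) m • v m) =
      ∑ m, (ξ₀ m + t * (((k : ℂ))⁻¹ * ∑ i ∈ S', om (κ i) m)) • v m := by
    rw [h1, Finset.smul_sum, Finset.smul_sum, ← Finset.sum_add_distrib]
    exact Finset.sum_congr rfl fun m _ => by rw [smul_smul, smul_smul, ← add_smul, mul_assoc]
  rw [one_mul, hpt]
  refine hsmall _ fun m => ?_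
  have hsum : ‖∑ i ∈ S', om (κ i) m‖ ≤ k * c_om := by
    refine (norm_sum_le _ _).trans ?_
    calc ∑ i ∈ S', ‖om (κ i) m‖ ≤ ∑ _i ∈ S', c_om := Finset.sum_le_sum fun i _ => hom _ _
      _ = S'.card * c_om := by rw [Finset.sum_const, nsmul_eq_mul]
      _ ≤ k * c_om := by
          refine mul_le_mul_of_nonneg_right ?_ hc_om
          exact_mod_cast (Finset.card_le_univ S').trans_eq (Fintype.card_fin k)
  have hkk : (k : ℝ)⁻¹ * (k * c_om) ≤ c_om := by
    rcases Nat.eq_zero_or_pos k with hk | hk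
    · subst hk; simp [hc_om]
    · rw [← mul_assoc, inv_mul_cancel₀ (by exact_mod_cast hk.ne'), one_mul]
  calc ‖ξ₀ m + t * (((k : ℂ))⁻¹ * ∑ i ∈ S', om (κ i) m)‖
      ≤ ‖ξ₀ m‖ + ‖t * (((k : ℂ))⁻¹ * ∑ i ∈ S', om (κ i) m)‖ := norm_add_le _ _
    _ = ‖ξ₀ m‖ + (k : ℝ)⁻¹ * ‖∑ i ∈ S', om (κ i) m‖ := by
        rw [norm_mul, ht, one_mul, norm_mul, norm_inv, Complex.norm_natCast]
    _ ≤ R₀ + (k : ℝ)⁻¹ * (k * c_om) :=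
        add_le_add (hξ₀ m) (mul_le_mul_of_nonneg_left hsum (inv_nonneg.2 (Nat.cast_nonneg _)))
    _ ≤ R₀ + c_om := add_le_add le_rfl hkk
    _ ≤ R := hR

variable {m : ℕ}

/-- **The points `exp_G(y_h)` are integral in the generators**: with `aᵢ` containing the
`y_{j,0,i}` and the `e^{y_{j,1,l}}`, the additive coordinates `∑ⱼ hⱼ y_{j,0,i}` of `exp_G(y_h)`,
`0 ≤ hⱼ ≤ S`, have bounds `(1, max(1, mS))` and the multiplicative ones `∏ⱼ (e^{y_{j,1,l}})^{hⱼ}`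
have bounds `(mS, 1)`. [cite: Waldschmidt1988, §6 (p. 389)] -/
theorem intPolyBound_coord_exp_latt {ι : Type*} {a : ι → ℂ}
    (y : Fin m → (Fin d₀ → ℂ) × (Fin d₁ → ℂ))
    (idx₀ : Fin m → Fin d₀ → ι) (ha₀ : ∀ j i, a (idx₀ j i) = (y j).1 i)
    (idx₁ : Fin m → Fin d₁ → ι) (ha₁ : ∀ j l, a (idx₁ j l) = cexp ((y j).2 l))
    (h : Fin m → ℕ) {S : ℕ} (hh : ∀ j, h j ≤ S) :
    (∀ i, IntPolyBound a (coord (exp (latt y fun j => (h j : ℤ))) (Sum.inl i)) 1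
      (max 1 ((m * S : ℕ) : ℝ))) ∧
    (∀ l, IntPolyBound a (coord (exp (latt y fun j => (h j : ℤ))) (Sum.inr l)) (m * S) 1) := by
  have hmS : ∑ j : Fin m, (h j : ℕ) ≤ m * S :=
    calc ∑ j, h j ≤ ∑ _j : Fin m, S := Finset.sum_le_sum fun j _ => hh j
      _ = m * S := by simp
  constructor
  · intro i
    rw [coord_inl, toAdd_exp_fst, latt_apply, Prod.fst_sum, Finset.sum_apply]
    have hterm : ∀ j ∈ (Finset.univ : Finset (Fin m)),
        IntPolyBound a (((h j : ℤ) • y j).1 i) 1 ((h j : ℕ) : ℝ) := by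
      intro j _
      have := (IntPolyBound.gen (a := a) (idx₀ j i)).intMul (h j : ℤ)
      simp only [ha₀, Int.cast_natCast, Nat.abs_cast, mul_one] at this
      rw [Prod.smul_fst, Pi.smul_apply, zsmul_eq_mul, Int.cast_natCast]
      exact this
    refine (IntPolyBound.sum Finset.univ hterm).mono le_rfl ?_
    refine le_trans ?_ (le_max_right _ _)
    exact_mod_cast hmS
  · intro l
    rw [coord_inr, coe_exp_snd, latt_apply, Prod.snd_sum, Finset.sum_apply, Complex.exp_sum]
    have hterm : ∀ j ∈ (Finset.univ : Finset (Fin m)),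
        IntPolyBound a (cexp (((h j : ℤ) • y j).2 l)) (h j * 1) ((1 : ℝ) ^ (h j)) := by
      intro j _
      have := (IntPolyBound.gen (a := a) (idx₁ j l)).pow (h j)
      rw [ha₁] at this
      rw [Prod.smul_snd, Pi.smul_apply, zsmul_eq_mul, Int.cast_natCast, Complex.exp_nat_mul]
      exact this
    have hprod := IntPolyBound.prod Finset.univ hterm
    simp only [mul_one, one_pow, Finset.prod_const_one] at hprod
    exact hprod.mono hmS le_rfl

/-- **Vanishing from smallness (Liouville)**: if, for every word of length `k < T` in the letters
`w` (coordinates among the generators) at the point `exp_G(y_h)`, `k! ×` its value on `P_p` is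
smaller than the Liouville threshold for the bounds of `intPolyBound_factorial_mul_wordDeriv_auxP`,
then `P_p` vanishes to order `≥ T` along `W ⊆ span(w)` at `exp_G(y_h)`.
[cite: Waldschmidt1988, §6 Proposition 6.1 (p. 389)] -/
theorem vanishesToOrder_auxP_of_small (G : AlgGens) (y : Fin m → (Fin d₀ → ℂ) × (Fin d₁ → ℂ))
    (idx₀ : Fin m → Fin d₀ → G.ι) (ha₀ : ∀ j i, G.a (idx₀ j i) = (y j).1 i)
    (idx₁ : Fin m → Fin d₁ → G.ι) (ha₁ : ∀ j l, G.a (idx₁ j l) = cexp ((y j).2 l))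
    {t : ℕ} (w : Fin t → (Fin d₀ → ℂ) × (Fin d₁ → ℂ))
    (hw₀ : ∀ k i, IntPolyBound G.a ((w k).1 i) 1 1) (hw₁ : ∀ k l, IntPolyBound G.a ((w k).2 l) 1 1)
    (W : Submodule ℂ ((Fin d₀ → ℂ) × (Fin d₁ → ℂ))) (hW : W ≤ Submodule.span ℂ (Set.range w))
    {E₀ E₁ : ℕ} (p : (Fin d₀ → Fin E₀) × (Fin d₁ → Fin E₁) → ℤ) {Pb : ℕ} (hp : ∀ lam, |p lam| ≤ Pb)
    (h : Fin m → ℕ) {S : ℕ} (hh : ∀ j, h j ≤ S) (T : ℕ)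
    (hlt : ∀ k < T, ∀ κ : Fin k → Fin t,
      ‖(k.factorial : ℂ) * evalAt (wordDeriv (fun i => w (κ i)) (auxP p))
          (exp (latt y fun j => (h j : ℤ)))‖ <
        ((|(G.den : ℝ)| ^ (d₀ * (E₀ - 1) * 1 + d₁ * (E₁ - 1) * (m * S) + k) *
          max 1 (2 ^ k * (Fintype.card ((Fin d₀ → Fin E₀) × (Fin d₁ → Fin E₁)) * Pb *
            ((max 1 (k * (1 : ℝ)) * ((d₀ * (E₀ - 1) : ℕ) + (d₁ * (E₁ - 1) : ℕ))) ^ k *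
              (max 1 ((m * S : ℕ) : ℝ) ^ (d₀ * (E₀ - 1)) * (1 : ℝ) ^ (d₁ * (E₁ - 1)))))) *
          G.M ^ (d₀ * (E₀ - 1) * 1 + d₁ * (E₁ - 1) * (m * S) + k)) ^ G.h)⁻¹) :
    VanishesToOrder (auxP p) W (exp (latt y fun j => (h j : ℤ))) T := by
  classical
  obtain ⟨hg₀, hg₁⟩ := intPolyBound_coord_exp_latt y idx₀ ha₀ idx₁ ha₁ h hh
  refine vanishesToOrder_of_span_words _ W _ T w hW fun k hk κ => ?_
  have hb := intPolyBound_factorial_mul_wordDeriv_auxP (a := G.a) w (L_w := 1) zero_le_one hw₀ hw₁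
    (g := 1) (v := latt y fun j => (h j : ℤ)) (le_max_left 1 ((m * S : ℕ) : ℝ)) le_rfl
    (fun i => by rw [one_mul]; exact hg₀ i) (fun l => by rw [one_mul]; exact hg₁ l) p hp κ
  rw [one_mul] at hb
  have h0 := IntPolyBound.eq_zero_of_norm_lt G (hb.mono le_rfl (le_max_right _ _)) (le_max_left _ _)
    (hlt k hk κ)
  rcases mul_eq_zero.1 h0 with h1 | h1
  · exact absurd h1 (by exact_mod_cast (Nat.factorial_pos k).ne')
  · exact h1

end Pieces

/-! ### Numerical lemmas for the parameters of the auxiliary function -/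

section Numerics

/-- `0 ≤ x ≤ e^{αΔ}`, `0 ≤ y ≤ e^{βΔ}` ⇒ `xy ≤ e^{(α+β)Δ}`. [folklore] -/
theorem mul_le_exp_mul {x y α β Δ : ℝ} (hy : 0 ≤ y) (hxa : x ≤ Real.exp (α * Δ))
    (hyb : y ≤ Real.exp (β * Δ)) : x * y ≤ Real.exp ((α + β) * Δ) := by
  rw [add_mul, Real.exp_add]
  exact mul_le_mul hxa hyb hy (Real.exp_nonneg _)

/-- Weakening an exponent: `x ≤ e^{αΔ}`, `α ≤ β`, `0 ≤ Δ` ⇒ `x ≤ e^{βΔ}`. [folklore] -/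
theorem le_exp_mul_of_le {x α β Δ : ℝ} (h : x ≤ Real.exp (α * Δ)) (hαβ : α ≤ β) (hΔ : 0 ≤ Δ) :
    x ≤ Real.exp (β * Δ) :=
  h.trans (Real.exp_le_exp.2 (mul_le_mul_of_nonneg_right hαβ hΔ))

/-- **The main parameter.** For `C ≥ 1`, `S ≥ 3`, `(log S)^{2d} ≤ S`, `log C ≤ log S`, with
`L = log S` and `Δ = Δ(S)` (`Δ^{d−n} = C S^{d₁} L^{2d₀}`): `L ≥ 1`, `Δ > 0`, `L² ≤ Δ`,
`log Δ ≤ (2d+1) L`. [cite: Waldschmidt1988, §7 (p. 390)] -/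
theorem auxDelta_facts {C : ℝ} (hC : 1 ≤ C) {d₀ d₁ n : ℕ} (hn : n < d₀ + d₁) {S : ℕ} (hS3 : 3 ≤ S)
    (hlogpow : Real.log S ^ (2 * (d₀ + d₁)) ≤ S) (hlogC : Real.log C ≤ Real.log S) :
    1 ≤ Real.log S ∧ 0 < auxDelta C d₀ d₁ n S ∧
      auxDelta C d₀ d₁ n S ^ (d₀ + d₁ - n) = C * (S : ℝ) ^ d₁ * Real.log S ^ (2 * d₀) ∧
      Real.log S ^ 2 ≤ auxDelta C d₀ d₁ n S ∧
      Real.log (auxDelta C d₀ d₁ n S) ≤ (2 * (d₀ + d₁ : ℕ) + 1) * Real.log S := by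
  set L := Real.log S with hL
  set dn := d₀ + d₁ - n with hdn
  have hdn0 : 0 < dn := by omega
  have hSpos : (0 : ℝ) < S := by exact_mod_cast (show 0 < S by omega)
  have hS1 : (1 : ℝ) ≤ S := by exact_mod_cast (show 1 ≤ S by omega)
  have hL1 : 1 ≤ L := by
    rw [hL, Real.le_log_iff_exp_le hSpos]
    have : (3 : ℝ) ≤ S := by exact_mod_cast hS3
    linarith [Real.exp_one_lt_three]
  have hLpos : 0 < L := by linarith
  have hCpos : 0 < C := by linarith
  set B : ℝ := C * (S : ℝ) ^ d₁ * L ^ (2 * d₀) with hB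
  have hBpos : 0 < B := by positivity
  set Δ := auxDelta C d₀ d₁ n S with hΔdef
  have hΔB : Δ ^ dn = B := by
    rw [hΔdef, auxDelta]
    exact Real.rpow_inv_natCast_pow hBpos.le hdn0.ne'
  have hΔpos : 0 < Δ := by rw [hΔdef, auxDelta]; exact Real.rpow_pos_of_pos hBpos _
  have hL2 : L ^ 2 ≤ Δ := by
    refine le_of_pow_le_pow_left₀ hdn0.ne' hΔpos.le ?_
    rw [hΔB, ← pow_mul]
    by_cases hd₁ : d₁ = 0
    · have h1 : L ^ (2 * dn) ≤ L ^ (2 * d₀) := pow_le_pow_right₀ hL1 (by omega)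
      refine h1.trans ?_
      rw [hB, hd₁, pow_zero, mul_one]
      exact le_mul_of_one_le_left (by positivity) hC
    · calc L ^ (2 * dn) ≤ L ^ (2 * (d₀ + d₁)) := pow_le_pow_right₀ hL1 (by omega)
        _ ≤ S := hlogpow
        _ ≤ (S : ℝ) ^ d₁ := le_self_pow₀ hS1 hd₁
        _ ≤ C * (S : ℝ) ^ d₁ := le_mul_of_one_le_left (by positivity) hC
        _ ≤ B := le_mul_of_one_le_right (by positivity) (one_le_pow₀ hL1)
  have hΔ1 : 1 ≤ Δ := le_trans (one_le_pow₀ hL1) hL2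
  have hlogΔ : Real.log Δ ≤ (2 * (d₀ + d₁ : ℕ) + 1) * L := by
    have hlogΔ0 : 0 ≤ Real.log Δ := Real.log_nonneg hΔ1
    have h1 : Real.log Δ ≤ dn * Real.log Δ :=
      le_mul_of_one_le_left hlogΔ0 (by exact_mod_cast hdn0)
    have h2 : (dn : ℝ) * Real.log Δ = Real.log B := by rw [← Real.log_pow, hΔB]
    have h3 : Real.log B = Real.log C + d₁ * L + 2 * d₀ * Real.log L := by
      rw [hB, Real.log_mul (by positivity) (by positivity),
        Real.log_mul (by positivity) (by positivity), Real.log_pow, Real.log_pow]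
      push_cast; ring
    have h4 : Real.log L ≤ L := (Real.log_le_sub_one_of_pos hLpos).trans (by linarith)
    have h6 : (0 : ℝ) ≤ 2 * d₀ := by positivity
    have h7 : (0 : ℝ) ≤ d₁ := by positivity
    calc Real.log Δ ≤ dn * Real.log Δ := h1
      _ = Real.log C + d₁ * L + 2 * d₀ * Real.log L := by rw [h2, h3]
      _ ≤ L + d₁ * L + 2 * d₀ * L := by
          have := mul_le_mul_of_nonneg_left h4 h6
          linarith
      _ ≤ (2 * (d₀ + d₁ : ℕ) + 1) * L := by push_cast; nlinarith
  exact ⟨hL1, hΔpos, hΔB, hL2, hlogΔ⟩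

/-- `Δ/q/k ≤ E`, `q > 0` ⇒ `Δ^k ≤ (qk)^k E^k` (also for `k = 0`). [folklore] -/
theorem pow_le_of_div_div_le {Δ q : ℝ} {E k : ℕ} (hΔ : 0 ≤ Δ) (hq : 0 < q) (hE : Δ / q / k ≤ E) :
    Δ ^ k ≤ (q * k) ^ k * (E : ℝ) ^ k := by
  rcases Nat.eq_zero_or_pos k with hk | hk
  · subst hk; simp
  · have hk' : (0 : ℝ) < k := by exact_mod_cast hk
    rw [← mul_pow]
    refine pow_le_pow_left₀ hΔ ?_ k
    have : Δ = Δ / q / k * (q * k) := by field_simp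
    rw [this]
    calc Δ / q / k * (q * k) ≤ E * (q * k) := mul_le_mul_of_nonneg_right hE (by positivity)
      _ = q * k * E := by ring

/-- **The number of unknowns is `≥ C Δⁿ / (d₀^{d₀} d₁^{d₁})`**: with `E₀ > Δ/(d₀L²)`,
`E₁ > Δ/(d₁S)` and `Δ^{d−n} = C S^{d₁} L^{2d₀}`, `C Δⁿ ≤ d₀^{d₀} d₁^{d₁} E₀^{d₀} E₁^{d₁}`.
[cite: Waldschmidt1988, §6 (p. 389)] -/
theorem C_mul_pow_le_card {C Δ L S : ℝ} {d₀ d₁ n E₀ E₁ : ℕ} (hn : n ≤ d₀ + d₁) (hΔ : 0 ≤ Δ)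
    (hL : 0 < L) (hS : 0 < S) (hΔB : Δ ^ (d₀ + d₁ - n) = C * S ^ d₁ * L ^ (2 * d₀))
    (hE₀ : Δ / L ^ 2 / d₀ ≤ E₀) (hE₁ : Δ / S / d₁ ≤ E₁) :
    C * Δ ^ n ≤ ((d₀ : ℝ) ^ d₀ * (d₁ : ℝ) ^ d₁) * ((E₀ : ℝ) ^ d₀ * (E₁ : ℝ) ^ d₁) := by
  have h0 := pow_le_of_div_div_le hΔ (by positivity : 0 < L ^ 2) hE₀
  have h1 := pow_le_of_div_div_le hΔ hS hE₁
  have h2 : Δ ^ d₀ * Δ ^ d₁ ≤ (L ^ 2 * d₀) ^ d₀ * (E₀ : ℝ) ^ d₀ * ((S * d₁) ^ d₁ * (E₁ : ℝ) ^ d₁) :=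
    mul_le_mul h0 h1 (by positivity) (by positivity)
  have hsplit : Δ ^ d₀ * Δ ^ d₁ = Δ ^ n * (C * S ^ d₁ * L ^ (2 * d₀)) := by
    rw [← hΔB, ← pow_add, ← pow_add]; congr 1; omega
  rw [hsplit, mul_pow, mul_pow, ← pow_mul] at h2
  have hpos : 0 < S ^ d₁ * L ^ (2 * d₀) := by positivity
  refine le_of_mul_le_mul_right ?_ hpos
  calc C * Δ ^ n * (S ^ d₁ * L ^ (2 * d₀)) = Δ ^ n * (C * S ^ d₁ * L ^ (2 * d₀)) := by ring
    _ ≤ _ := h2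
    _ = (d₀ : ℝ) ^ d₀ * (d₁ : ℝ) ^ d₁ * ((E₀ : ℝ) ^ d₀ * (E₁ : ℝ) ^ d₁) * (S ^ d₁ * L ^ (2 * d₀)) := by
        ring

/-- **The box-principle count** `k_b^{2N^n} < (P_b+1)^U` from `log k_b ≤ (n+1)(c+5)Δ`,
`N ≤ (c+3)Δ`, `P_b + 1 > e^Δ`, `C Δⁿ ≤ c_dd U` and `C ≥ 2 c_dd (n+1)(c+5)^{n+1}`.
[cite: Waldschmidt1988, §6 (p. 389)] -/
theorem count_lt {C Δ cdd cs : ℝ} {n kb Pb U N : ℕ} (hΔ : 1 ≤ Δ) (hcs : 0 ≤ cs)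
    (hkb : (kb : ℝ) ≤ Real.exp (((n + 1) * (cs + 5)) * Δ)) (hkb0 : 0 < kb)
    (hN : (N : ℝ) ≤ (cs + 3) * Δ) (hPb : Real.exp Δ < Pb + 1)
    (hU : C * Δ ^ n ≤ cdd * U) (hcdd : 0 < cdd) (hU0 : 0 < U)
    (hC : 2 * cdd * (n + 1) * (cs + 5) ^ (n + 1) ≤ C) :
    kb ^ (2 * N ^ n) < (Pb + 1) ^ U := by
  have hΔ0 : 0 ≤ Δ := zero_le_one.trans hΔ
  have hkbpos : (0 : ℝ) < kb := by exact_mod_cast hkb0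
  have hPbpos : (0 : ℝ) < Pb + 1 := by positivity
  have hlogkb : Real.log kb ≤ ((n + 1) * (cs + 5)) * Δ := by
    rw [Real.log_le_iff_le_exp hkbpos]; exact hkb
  have hlogkb0 : 0 ≤ Real.log kb := Real.log_nonneg (by exact_mod_cast hkb0)
  have hlogPb : Δ < Real.log (Pb + 1) := by
    rw [Real.lt_log_iff_exp_lt hPbpos]; exact hPb
  -- compare logarithms
  have hNn : ((N : ℝ)) ^ n ≤ ((cs + 3) * Δ) ^ n := pow_le_pow_left₀ (Nat.cast_nonneg _) hN n
  have key : (2 * N ^ n : ℕ) * Real.log kb < U * Real.log (Pb + 1) := by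
    have h1 : ((2 * N ^ n : ℕ) : ℝ) * Real.log kb ≤
        2 * ((cs + 3) * Δ) ^ n * (((n + 1) * (cs + 5)) * Δ) := by
      push_cast
      exact mul_le_mul (mul_le_mul_of_nonneg_left hNn (by norm_num)) hlogkb hlogkb0 (by positivity)
    have h3 : ((cs + 3) * Δ) ^ n ≤ ((cs + 5) * Δ) ^ n :=
      pow_le_pow_left₀ (by positivity) (by nlinarith) n
    have h2 : 2 * ((cs + 3) * Δ) ^ n * (((n + 1) * (cs + 5)) * Δ) ≤
        (2 * (n + 1) * (cs + 5) ^ (n + 1)) * Δ ^ (n + 1) := by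
      calc 2 * ((cs + 3) * Δ) ^ n * (((n + 1) * (cs + 5)) * Δ)
          ≤ 2 * ((cs + 5) * Δ) ^ n * (((n + 1) * (cs + 5)) * Δ) := by gcongr
        _ = (2 * (n + 1) * (cs + 5) ^ (n + 1)) * Δ ^ (n + 1) := by rw [mul_pow]; ring
    -- multiply through by `c_dd > 0`
    have h4 : cdd * ((2 * (n + 1) * (cs + 5) ^ (n + 1)) * Δ ^ (n + 1)) ≤ C * Δ ^ (n + 1) := by
      rw [← mul_assoc]
      refine mul_le_mul_of_nonneg_right ?_ (by positivity)
      calc cdd * (2 * (n + 1) * (cs + 5) ^ (n + 1)) = 2 * cdd * (n + 1) * (cs + 5) ^ (n + 1) := by ring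
        _ ≤ C := hC
    have h5 : C * Δ ^ (n + 1) ≤ cdd * (U * Δ) := by
      calc C * Δ ^ (n + 1) = C * Δ ^ n * Δ := by ring
        _ ≤ cdd * U * Δ := mul_le_mul_of_nonneg_right hU hΔ0
        _ = cdd * (U * Δ) := by ring
    have h6 : (U : ℝ) * Δ < U * Real.log (Pb + 1) :=
      mul_lt_mul_of_pos_left hlogPb (by exact_mod_cast hU0)
    have h7 : cdd * (((2 * N ^ n : ℕ) : ℝ) * Real.log kb) < cdd * (U * Real.log (Pb + 1)) := by
      calc cdd * (((2 * N ^ n : ℕ) : ℝ) * Real.log kb)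
          ≤ cdd * ((2 * (n + 1) * (cs + 5) ^ (n + 1)) * Δ ^ (n + 1)) :=
            mul_le_mul_of_nonneg_left (h1.trans h2) hcdd.le
        _ ≤ cdd * (U * Δ) := h4.trans h5
        _ < cdd * (U * Real.log (Pb + 1)) := mul_lt_mul_of_pos_left h6 hcdd
    exact lt_of_mul_lt_mul_left h7 hcdd.le
  -- back to naturals
  have hreal : ((kb ^ (2 * N ^ n) : ℕ) : ℝ) < (((Pb + 1) ^ U : ℕ) : ℝ) := by
    push_cast
    rw [← Real.exp_log (pow_pos hkbpos _), ← Real.exp_log (pow_pos hPbpos _), Real.exp_lt_exp,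
      Real.log_pow, Real.log_pow]
    exact_mod_cast key
  exact_mod_cast hreal

/-- **`k! 2^k k^k ≤ e^{(8d+10)Δ}`** for `k ≤ T ≤ 2Δ/L`, `log Δ ≤ (2d+1)L`, `L ≥ 1`. [folklore] -/
theorem factorial_mul_le_exp {d k T : ℕ} {Δ L : ℝ} (hL : 1 ≤ L) (hΔ : 1 ≤ Δ) (hkT : k ≤ T)
    (hT : (T : ℝ) ≤ 2 * Δ / L) (hlogΔ : Real.log Δ ≤ (2 * d + 1) * L) :
    (k.factorial : ℝ) * 2 ^ k * (k : ℝ) ^ k ≤ Real.exp ((8 * d + 10) * Δ) := by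
  have hLpos : 0 < L := by linarith
  have hΔpos : 0 < Δ := by linarith
  have hT' : (k : ℝ) ≤ T := by exact_mod_cast hkT
  -- `k! 2^k k^k ≤ (2T²)^k ≤ (2T²)^T`
  have hfac : (k.factorial : ℝ) ≤ (k : ℝ) ^ k := by exact_mod_cast Nat.factorial_le_pow k
  have h1 : (k.factorial : ℝ) * 2 ^ k * (k : ℝ) ^ k ≤ (2 * (T : ℝ) ^ 2) ^ k := by
    calc (k.factorial : ℝ) * 2 ^ k * (k : ℝ) ^ k ≤ (k : ℝ) ^ k * 2 ^ k * (k : ℝ) ^ k := by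
          gcongr
      _ ≤ (T : ℝ) ^ k * 2 ^ k * (T : ℝ) ^ k := by gcongr
      _ = (2 * (T : ℝ) ^ 2) ^ k := by rw [mul_pow, ← pow_mul, pow_mul']; ring
  -- `2T² ≤ 8Δ² ≤ e^{(4d+5)L}`
  have h2 : 2 * (T : ℝ) ^ 2 ≤ Real.exp ((4 * d + 5) * L) := by
    have hT2 : (T : ℝ) ≤ 2 * Δ := hT.trans (by rw [div_le_iff₀ hLpos]; nlinarith)
    have h8 : 2 * (T : ℝ) ^ 2 ≤ 8 * Δ ^ 2 := by nlinarith
    refine h8.trans ?_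
    rw [← Real.log_le_iff_le_exp (by positivity), Real.log_mul (by norm_num) (by positivity),
      Real.log_pow]
    have hlog8 : Real.log 8 ≤ 3 := by
      rw [Real.log_le_iff_le_exp (by norm_num)]
      have he := Real.exp_one_gt_d9
      have h3 : Real.exp 3 = Real.exp 1 ^ 3 := by rw [← Real.exp_nat_mul]; norm_num
      have h27 : (2.7 : ℝ) ^ 3 ≤ Real.exp 1 ^ 3 := pow_le_pow_left₀ (by norm_num) (by linarith) 3
      rw [h3]; nlinarith [h27]
    push_cast
    nlinarith [Real.log_nonneg hΔ]
  have h3 : (2 * (T : ℝ) ^ 2) ^ k ≤ (2 * (T : ℝ) ^ 2) ^ T := by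
    rcases Nat.eq_zero_or_pos T with hT0 | hT0
    · subst hT0; have : k = 0 := by omega
      subst this; simp
    · exact pow_le_pow_right₀ (by
        have : (1 : ℝ) ≤ T := by exact_mod_cast hT0
        nlinarith) hkT
  have h4 : (2 * (T : ℝ) ^ 2) ^ T ≤ Real.exp ((4 * d + 5) * L) ^ T :=
    pow_le_pow_left₀ (by positivity) h2 T
  have h5 : Real.exp ((4 * d + 5) * L) ^ T ≤ Real.exp ((8 * d + 10) * Δ) := by
    rw [← Real.exp_nat_mul, Real.exp_le_exp]
    calc (T : ℝ) * ((4 * d + 5) * L) ≤ 2 * Δ / L * ((4 * d + 5) * L) :=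
          mul_le_mul_of_nonneg_right hT (by positivity)
      _ = (8 * d + 10) * Δ := by field_simp; ring
  exact h1.trans (h3.trans (h4.trans h5))

set_option maxHeartbeats 400000 in
/-- **The smallness bound** `ε₁ + ε₂ ≤ e^{−c_V Δ}` for the two error terms of
`exists_small_universal` with the parameters of the auxiliary function. [folklore] -/
theorem eps_le_exp_neg {n N kb Pb Ttr : ℕ} {Δ U G₀ ρ A₀ cG cV cs d : ℝ} (hΔ : 1 ≤ Δ)
    (hU1 : 1 ≤ U) (hU : U ≤ Real.exp (d * Δ)) (hG1 : 1 ≤ G₀) (hG : G₀ ≤ Real.exp (cG * Δ))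
    (hρ0 : 0 ≤ ρ) (hρ : ρ ≤ A₀ * Δ) (hPb1 : 1 ≤ Pb) (hPb : (Pb : ℝ) ≤ Real.exp Δ)
    (hTtr : cs * Δ ≤ Ttr) (hkb : Real.exp (((n + 1) * (cs + 4)) * Δ) ≤ kb)
    (hN : (N : ℝ) ≤ (cs + 3) * Δ) (hd : 0 ≤ d) (hcG : 0 ≤ cG) (hA₀ : 0 ≤ A₀) (hcV : 0 ≤ cV)
    (hcs : d + cG + n * A₀ + 2 * n + cV + 4 ≤ cs) :
    (N : ℝ) ^ n * (2 * ((2 * U * (G₀ * Real.exp ρ ^ n) * Pb + 1) / kb)) +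
        U * Pb * (G₀ * (n * Real.exp ρ ^ n * (2 * Real.exp (-(Ttr : ℝ))))) ≤ Real.exp (-cV * Δ) := by
  have hΔ0 : 0 ≤ Δ := zero_le_one.trans hΔ
  have hcs0 : 0 ≤ cs := by nlinarith
  have hkbpos : (0 : ℝ) < kb := lt_of_lt_of_le (Real.exp_pos _) hkb
  have hexpρ : Real.exp ρ ^ n ≤ Real.exp ((n * A₀) * Δ) := by
    rw [← Real.exp_nat_mul, Real.exp_le_exp]
    calc (n : ℝ) * ρ ≤ n * (A₀ * Δ) := mul_le_mul_of_nonneg_left hρ (Nat.cast_nonneg _)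
      _ = n * A₀ * Δ := by ring
  have hexpρ1 : 1 ≤ Real.exp ρ ^ n := one_le_pow₀ (Real.one_le_exp hρ0)
  have hPb' : (Pb : ℝ) ≤ Real.exp (1 * Δ) := by rwa [one_mul]
  have hPb1' : (1 : ℝ) ≤ Pb := by exact_mod_cast hPb1
  -- the common product `X = U G₀ e^{nρ} P_b ≤ e^{(d + c_G + nA₀ + 1)Δ}`, `X ≥ 1`
  have hX : U * (G₀ * Real.exp ρ ^ n) * Pb ≤ Real.exp ((d + cG + n * A₀ + 1) * Δ) := by
    have h1 := mul_le_exp_mul (by positivity) hG hexpρ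
    have h2 := mul_le_exp_mul (by positivity) hU h1
    have h3 := mul_le_exp_mul (by positivity) h2 hPb'
    convert h3 using 2; ring
  have hX1 : 1 ≤ U * (G₀ * Real.exp ρ ^ n) * Pb :=
    one_le_mul_of_one_le_of_one_le (one_le_mul_of_one_le_of_one_le hU1
      (one_le_mul_of_one_le_of_one_le hG1 hexpρ1)) hPb1'
  have h2e : (2 : ℝ) ≤ Real.exp Δ := by
    have := Real.add_one_le_exp Δ; linarith
  have h6e : (6 : ℝ) ≤ Real.exp (2 * Δ) := by
    have h2 : Real.exp (2 * Δ) = Real.exp Δ ^ 2 := by rw [← Real.exp_nat_mul]; norm_num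
    have he := Real.exp_one_gt_d9
    have h1Δ : Real.exp 1 ≤ Real.exp Δ := Real.exp_le_exp.2 hΔ
    have h27 : (2.7 : ℝ) ^ 2 ≤ Real.exp Δ ^ 2 := pow_le_pow_left₀ (by norm_num) (by linarith) 2
    rw [h2]; nlinarith [h27]
  -- ε₁
  have hε₁ : (N : ℝ) ^ n * (2 * ((2 * U * (G₀ * Real.exp ρ ^ n) * Pb + 1) / kb)) ≤
      Real.exp (-(cV + 2) * Δ) := by
    have hNn : (N : ℝ) ^ n ≤ Real.exp ((n * (cs + 3)) * Δ) := by
      have h0 : (N : ℝ) ≤ Real.exp ((cs + 3) * Δ) :=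
        hN.trans (by linarith [Real.add_one_le_exp ((cs + 3) * Δ)])
      have := pow_le_pow_left₀ (Nat.cast_nonneg N) h0 n
      rw [← Real.exp_nat_mul] at this
      have e : (n : ℝ) * ((cs + 3) * Δ) = (n * (cs + 3)) * Δ := by ring
      rwa [e] at this
    have hnum : 2 * ((2 * U * (G₀ * Real.exp ρ ^ n) * Pb + 1)) ≤ Real.exp ((d + cG + n * A₀ + 3) * Δ) := by
      calc 2 * ((2 * U * (G₀ * Real.exp ρ ^ n) * Pb + 1)) ≤ 6 * (U * (G₀ * Real.exp ρ ^ n) * Pb) := by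
            nlinarith
        _ ≤ Real.exp (2 * Δ) * Real.exp ((d + cG + n * A₀ + 1) * Δ) :=
            mul_le_mul h6e hX (by positivity) (by positivity)
        _ = Real.exp ((d + cG + n * A₀ + 3) * Δ) := by rw [← Real.exp_add]; ring_nf
    have hinv : (kb : ℝ)⁻¹ ≤ Real.exp ((-((n + 1) * (cs + 4))) * Δ) := by
      rw [neg_mul, Real.exp_neg]
      exact inv_anti₀ (Real.exp_pos _) hkb
    have h1 := mul_le_exp_mul (by positivity) hnum hinv
    have h2 := mul_le_exp_mul (by positivity) hNn h1
    have h3 : (N : ℝ) ^ n * (2 * ((2 * U * (G₀ * Real.exp ρ ^ n) * Pb + 1) / kb)) =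
        (N : ℝ) ^ n * (2 * ((2 * U * (G₀ * Real.exp ρ ^ n) * Pb + 1)) * (kb : ℝ)⁻¹) := by ring
    rw [h3]
    refine le_exp_mul_of_le h2 ?_ hΔ0
    nlinarith
  -- ε₂
  have hε₂ : U * Pb * (G₀ * (n * Real.exp ρ ^ n * (2 * Real.exp (-(Ttr : ℝ))))) ≤ Real.exp (-(cV + 2) * Δ) := by
    have h2n : (2 * n : ℝ) ≤ Real.exp ((2 * n) * Δ) := by
      calc (2 * n : ℝ) ≤ 2 * n * Δ := le_mul_of_one_le_right (by positivity) hΔ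
        _ ≤ Real.exp (2 * n * Δ) := by linarith [Real.add_one_le_exp (2 * n * Δ)]
    have hT : Real.exp (-(Ttr : ℝ)) ≤ Real.exp ((-cs) * Δ) := by
      rw [Real.exp_le_exp]; linarith
    have h1 := mul_le_exp_mul (by positivity) hX h2n
    have h2 := mul_le_exp_mul (by positivity) h1 hT
    have h3 : U * Pb * (G₀ * (n * Real.exp ρ ^ n * (2 * Real.exp (-(Ttr : ℝ))))) =
        U * (G₀ * Real.exp ρ ^ n) * Pb * (2 * n) * Real.exp (-(Ttr : ℝ)) := by ring
    rw [h3]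
    refine le_exp_mul_of_le h2 ?_ hΔ0
    nlinarith
  -- sum
  calc _ ≤ Real.exp (-(cV + 2) * Δ) + Real.exp (-(cV + 2) * Δ) := add_le_add hε₁ hε₂
    _ = 2 * Real.exp (-(cV + 2) * Δ) := by ring
    _ ≤ Real.exp Δ * Real.exp (-(cV + 2) * Δ) := mul_le_mul_of_nonneg_right h2e (Real.exp_nonneg _)
    _ = Real.exp (-(cV + 1) * Δ) := by rw [← Real.exp_add]; ring_nf
    _ ≤ Real.exp (-cV * Δ) := Real.exp_le_exp.2 (by nlinarith)

/-- **The Liouville threshold** `((D^e · L_max · M^e)^h)⁻¹ ≥ e^{−c_L Δ}` when `e ≤ (m+3)Δ`,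
`L_max ≤ e^{c Δ}`, `c_L = h((m+3)(log D + log M) + c)`. [folklore] -/
theorem exp_neg_le_threshold {Dn MG Lmax Δ c : ℝ} {e hG m : ℕ} (hDn : 1 ≤ Dn) (hMG : 1 ≤ MG)
    (he : (e : ℝ) ≤ (m + 3) * Δ) (hLpos : 0 < Lmax) (hLmax : Lmax ≤ Real.exp (c * Δ)) :
    Real.exp (-(hG * ((m + 3) * (Real.log Dn + Real.log MG) + c)) * Δ) ≤
      ((Dn ^ e * Lmax * MG ^ e) ^ hG)⁻¹ := by
  have hDpos : 0 < Dn := by linarith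
  have hMpos : 0 < MG := by linarith
  have hlD : 0 ≤ Real.log Dn := Real.log_nonneg hDn
  have hlM : 0 ≤ Real.log MG := Real.log_nonneg hMG
  have hX : Dn ^ e * Lmax * MG ^ e ≤ Real.exp (((m + 3) * (Real.log Dn + Real.log MG) + c) * Δ) := by
    have h1 : Dn ^ e ≤ Real.exp (((m + 3) * Real.log Dn) * Δ) := by
      rw [← Real.exp_log hDpos, ← Real.exp_nat_mul, Real.exp_log hDpos, Real.exp_le_exp]
      calc (e : ℝ) * Real.log Dn ≤ (m + 3) * Δ * Real.log Dn := mul_le_mul_of_nonneg_right he hlD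
        _ = (m + 3) * Real.log Dn * Δ := by ring
    have h2 : MG ^ e ≤ Real.exp (((m + 3) * Real.log MG) * Δ) := by
      rw [← Real.exp_log hMpos, ← Real.exp_nat_mul, Real.exp_log hMpos, Real.exp_le_exp]
      calc (e : ℝ) * Real.log MG ≤ (m + 3) * Δ * Real.log MG := mul_le_mul_of_nonneg_right he hlM
        _ = (m + 3) * Real.log MG * Δ := by ring
    have h3 := mul_le_exp_mul hLpos.le h1 hLmax
    have h4 := mul_le_exp_mul (by positivity) h3 h2
    convert h4 using 2; ring
  have hXh : (Dn ^ e * Lmax * MG ^ e) ^ hG ≤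
      Real.exp ((hG * ((m + 3) * (Real.log Dn + Real.log MG) + c)) * Δ) := by
    have := pow_le_pow_left₀ (by positivity) hX hG
    rw [← Real.exp_nat_mul] at this
    have e' : (hG : ℝ) * (((m + 3) * (Real.log Dn + Real.log MG) + c) * Δ) =
        (hG * ((m + 3) * (Real.log Dn + Real.log MG) + c)) * Δ := by ring
    rwa [e'] at this
  rw [neg_mul, Real.exp_neg]
  exact inv_anti₀ (by positivity) hXh

/-- **The length bound** of the word values: `2^k U P_b (max(1,k)(A+B))^k max(1,mS)^A ≤ e^{(9d+m+12)Δ}`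
for `k ≤ T ≤ 2Δ/L`, `A ≤ Δ/L²`, `B ≤ Δ`, `U ≤ e^{dΔ}`, `P_b ≤ e^Δ`, `L = log S ≥ 1`, `log Δ ≤ (2d+1)L`.
[folklore] -/
theorem length_le_exp {k T A B m S d : ℕ} {Δ L U : ℝ} {Pb : ℕ} (hL : 1 ≤ L) (hΔ : 1 ≤ Δ)
    (hSL : Real.log S = L) (hS : 1 ≤ S) (hkT : k ≤ T) (hT : (T : ℝ) ≤ 2 * Δ / L)
    (hlogΔ : Real.log Δ ≤ (2 * d + 1) * L) (hA : (A : ℝ) ≤ Δ / L ^ 2) (hB : (B : ℝ) ≤ Δ)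
    (hU0 : 0 ≤ U) (hU : U ≤ Real.exp (d * Δ)) (hPb : (Pb : ℝ) ≤ Real.exp Δ) :
    2 ^ k * (U * Pb * ((max 1 (k * (1 : ℝ)) * ((A : ℝ) + (B : ℝ))) ^ k *
      (max 1 ((m * S : ℕ) : ℝ) ^ A * (1 : ℝ) ^ B))) ≤ Real.exp ((9 * d + m + 12) * Δ) := by
  have hLpos : 0 < L := by linarith
  have hΔpos : 0 < Δ := by linarith
  have hΔ0 : 0 ≤ Δ := hΔpos.le
  have hΔL : Δ / L ^ 2 ≤ Δ := div_le_self hΔ0 (one_le_pow₀ hL)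
  have hA' : (A : ℝ) ≤ Δ := hA.trans hΔL
  have hT2 : (T : ℝ) ≤ 2 * Δ := hT.trans (by rw [div_le_iff₀ hLpos]; nlinarith)
  have hk2 : (k : ℝ) ≤ 2 * Δ := le_trans (by exact_mod_cast hkT) hT2
  -- `2^k ≤ e^{2Δ}`
  have h2k : (2 : ℝ) ^ k ≤ Real.exp (2 * Δ) := by
    have h2e : (2 : ℝ) ≤ Real.exp 1 := by have := Real.add_one_le_exp (1 : ℝ); linarith
    calc (2 : ℝ) ^ k ≤ Real.exp 1 ^ k := pow_le_pow_left₀ (by norm_num) h2e k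
      _ = Real.exp k := by rw [← Real.exp_nat_mul, mul_one]
      _ ≤ Real.exp (2 * Δ) := Real.exp_le_exp.2 hk2
  -- `(max(1,k)(A+B))^k ≤ (4Δ²)^T ≤ e^{(8d+8)Δ}`
  have hbase : max 1 (k * (1 : ℝ)) * ((A : ℝ) + (B : ℝ)) ≤ 4 * Δ ^ 2 := by
    have hm : max 1 (k * (1 : ℝ)) ≤ 2 * Δ := by
      rw [mul_one]; exact max_le (by linarith) hk2
    calc max 1 (k * (1 : ℝ)) * ((A : ℝ) + (B : ℝ)) ≤ 2 * Δ * (Δ + Δ) :=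
          mul_le_mul hm (add_le_add hA' hB) (by positivity) (by positivity)
      _ = 4 * Δ ^ 2 := by ring
  have h4Δ : 4 * Δ ^ 2 ≤ Real.exp ((4 * d + 4) * L) := by
    rw [← Real.log_le_iff_le_exp (by positivity), Real.log_mul (by norm_num) (by positivity),
      Real.log_pow]
    have hlog4 : Real.log 4 ≤ 2 := by
      rw [Real.log_le_iff_le_exp (by norm_num)]
      have he := Real.exp_one_gt_d9
      have h3 : Real.exp 2 = Real.exp 1 ^ 2 := by rw [← Real.exp_nat_mul]; norm_num
      have h27 : (2.7 : ℝ) ^ 2 ≤ Real.exp 1 ^ 2 := pow_le_pow_left₀ (by norm_num) (by linarith) 2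
      rw [h3]; nlinarith [h27]
    push_cast
    nlinarith [Real.log_nonneg hΔ]
  have hmid : (max 1 (k * (1 : ℝ)) * ((A : ℝ) + (B : ℝ))) ^ k ≤ Real.exp ((8 * d + 8) * Δ) := by
    have h14 : (1 : ℝ) ≤ 4 * Δ ^ 2 := by nlinarith
    calc (max 1 (k * (1 : ℝ)) * ((A : ℝ) + (B : ℝ))) ^ k ≤ (4 * Δ ^ 2) ^ k :=
          pow_le_pow_left₀ (by positivity) hbase k
      _ ≤ (4 * Δ ^ 2) ^ T := pow_le_pow_right₀ h14 hkT
      _ ≤ Real.exp ((4 * d + 4) * L) ^ T := pow_le_pow_left₀ (by positivity) h4Δ T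
      _ = Real.exp (T * ((4 * d + 4) * L)) := by rw [← Real.exp_nat_mul]
      _ ≤ Real.exp ((8 * d + 8) * Δ) := by
          rw [Real.exp_le_exp]
          calc (T : ℝ) * ((4 * d + 4) * L) ≤ 2 * Δ / L * ((4 * d + 4) * L) :=
                mul_le_mul_of_nonneg_right hT (by positivity)
            _ = (8 * d + 8) * Δ := by field_simp; ring
  -- `max(1, mS)^A ≤ e^{(m+1)Δ}`
  have hlast : max 1 ((m * S : ℕ) : ℝ) ^ A ≤ Real.exp ((m + 1) * Δ) := by
    have hS' : (1 : ℝ) ≤ S := by exact_mod_cast hS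
    have hSpos : (0 : ℝ) < S := by linarith
    have hmax : max 1 ((m * S : ℕ) : ℝ) ≤ (m + 1) * S := by
      push_cast
      refine max_le (by nlinarith) (by nlinarith)
    have hlogmax : Real.log (max 1 ((m * S : ℕ) : ℝ)) ≤ m + L := by
      calc Real.log (max 1 ((m * S : ℕ) : ℝ)) ≤ Real.log ((m + 1) * S) :=
            Real.log_le_log (by positivity) hmax
        _ = Real.log (m + 1) + L := by rw [Real.log_mul (by positivity) hSpos.ne', hSL]
        _ ≤ m + L := by
            have := Real.log_le_sub_one_of_pos (show (0 : ℝ) < m + 1 by positivity)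
            linarith
    have hmaxpos : 0 < max 1 ((m * S : ℕ) : ℝ) := lt_of_lt_of_le zero_lt_one (le_max_left _ _)
    rw [← Real.exp_log hmaxpos, ← Real.exp_nat_mul, Real.exp_le_exp]
    calc (A : ℝ) * Real.log (max 1 ((m * S : ℕ) : ℝ)) ≤ Δ / L ^ 2 * (m + L) :=
          mul_le_mul hA hlogmax (Real.log_nonneg (le_max_left _ _)) (by positivity)
      _ = m * (Δ / L ^ 2) + Δ / L := by field_simp
      _ ≤ m * Δ + Δ := by
          have h1 : Δ / L ≤ Δ := div_le_self hΔ0 hL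
          have h2 : (m : ℝ) * (Δ / L ^ 2) ≤ m * Δ := mul_le_mul_of_nonneg_left hΔL (Nat.cast_nonneg _)
          linarith
      _ = (m + 1) * Δ := by ring
  -- assemble
  have hPb' : (Pb : ℝ) ≤ Real.exp (1 * Δ) := by rwa [one_mul]
  have hlast' : max 1 ((m * S : ℕ) : ℝ) ^ A * (1 : ℝ) ^ B ≤ Real.exp ((m + 1) * Δ) := by
    rw [one_pow, mul_one]; exact hlast
  have h1 := mul_le_exp_mul (by positivity) hU hPb'
  have h23 := mul_le_exp_mul (by positivity) hmid hlast'
  have h3 := mul_le_exp_mul (by positivity) h1 h23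
  have h4 := mul_le_exp_mul (by positivity) h2k h3
  refine le_exp_mul_of_le h4 ?_ hΔ0
  nlinarith

end Numerics

/-! ### The auxiliary function of Proposition 6.1 -/

section Main

variable {d₀ d₁ m : ℕ}

/-- `k ⌊x/k⌋ ≤ x` for `x ≥ 0` (also for `k = 0`). [folklore] -/
theorem natMul_floor_div_le {x : ℝ} (hx : 0 ≤ x) (k : ℕ) : ((k * ⌊x / k⌋₊ : ℕ) : ℝ) ≤ x := by
  rcases Nat.eq_zero_or_pos k with hk | hk
  · subst hk; simpa using hx
  · have hk' : (0 : ℝ) < k := by exact_mod_cast hk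
    push_cast
    calc (k : ℝ) * ⌊x / k⌋₊ ≤ k * (x / k) :=
          mul_le_mul_of_nonneg_left (Nat.floor_le (div_nonneg hx hk'.le)) hk'.le
      _ = x := mul_div_cancel₀ x hk'.ne'

set_option maxHeartbeats 1600000 in
/-- **The auxiliary function (Waldschmidt 1988, Proposition 6.1 for `G = 𝔾ₐ^{d₀} × 𝔾ₘ^{d₁}`, no
periods, `a = 1`, `b = 2`).** Let `V ⊊ Lie G` of dimension `n < d`, `W ⊆ V` spanned by finitely many
vectors `w_k ∈ W` with algebraic coordinates, and `y₁, …, y_m ∈ V` with `y_{j,0,i} ∈ ℚ̄` and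
`e^{y_{j,1,l}} ∈ ℚ̄`. There is `C ≥ 1` such that for all large `S`, with
`Δ = (C S^{d₁} (log S)^{2d₀})^{1/(d−n)}`, there is a non-zero polynomial `P` with
`deg_X P ≤ Δ/(log S)²`, `deg_Y P ≤ Δ/S`, such that `F = P ∘ exp_G` has a zero of order `≥ T ≥ Δ/log S`
along `W` at each point `h₁y₁ + ⋯ + h_my_m`, `0 ≤ hⱼ ≤ S` — exactly the hypothesis `hAF` of
`weakObstruction_of_zeroEstimate_of_auxiliary`. Proof: the universal auxiliary function
(`exists_small_universal`, box principle) makes `|F| ≤ e^{−c_V Δ}` on the ball of radius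
`≈ S` of `V`; Cauchy + polarisation bound the mixed jets along `W` (= values of words of invariant
derivations) by `2^k k^k e^{−c_V Δ}`; these values, times `k!`, are integer polynomials in the
algebraic data of controlled degree `O(Δ)` and length `e^{O(Δ)}`, so Liouville's inequality forces
them to vanish. [cite: Waldschmidt1988, §6 Proposition 6.1 (p. 389)]
[cite: Waldschmidt1981, §3 Théorème 3.1, §4 (pp. 100–105)] -/
theorem auxiliaryFunction (y : Fin m → (Fin d₀ → ℂ) × (Fin d₁ → ℂ))
    (W V : Submodule ℂ ((Fin d₀ → ℂ) × (Fin d₁ → ℂ))) (hyV : ∀ j, y j ∈ V) (hWV : W ≤ V)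
    (hV : Module.finrank ℂ V < d₀ + d₁)
    (halg₀ : ∀ j i, IsAlgebraic ℚ ((y j).1 i)) (halg₁ : ∀ j l, IsAlgebraic ℚ (cexp ((y j).2 l)))
    {t : ℕ} (w : Fin t → (Fin d₀ → ℂ) × (Fin d₁ → ℂ)) (hwW : ∀ k, w k ∈ W)
    (hWspan : W ≤ Submodule.span ℂ (Set.range w))
    (hwalg₀ : ∀ k i, IsAlgebraic ℚ ((w k).1 i)) (hwalg₁ : ∀ k l, IsAlgebraic ℚ ((w k).2 l)) :
    ∃ (C : ℝ) (S₀ : ℕ), 1 ≤ C ∧ ∀ S : ℕ, S₀ ≤ S →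
      ∃ (P : MvPolynomial (Fin d₀ ⊕ Fin d₁) ℂ) (T : ℕ), P ≠ 0 ∧
        auxDelta C d₀ d₁ (Module.finrank ℂ V) S / Real.log S ≤ T ∧
        (degX P : ℝ) ≤ auxDelta C d₀ d₁ (Module.finrank ℂ V) S / Real.log S ^ 2 ∧
        (degY P : ℝ) ≤ auxDelta C d₀ d₁ (Module.finrank ℂ V) S / S ∧
        ∀ h : Fin m → ℕ, (∀ j, h j ≤ S) →
          VanishesToOrder P W (exp (latt y fun j => (h j : ℤ))) T := by
  classical
  set n := Module.finrank ℂ V with hn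
  /- a basis of `V`; coordinates of the `yⱼ` and of the letters `w_k` -/
  obtain ⟨v, ζ, om, hy_repr, hw_repr⟩ : ∃ (v : Fin n → (Fin d₀ → ℂ) × (Fin d₁ → ℂ))
      (ζ : Fin m → Fin n → ℂ) (om : Fin t → Fin n → ℂ),
      (∀ j, y j = ∑ m', ζ j m' • v m') ∧ (∀ k, w k = ∑ m', om k m' • v m') := by
    let bV := Module.finBasis ℂ V
    refine ⟨fun m' => (bV m' : _), fun j m' => bV.repr ⟨y j, hyV j⟩ m',
      fun k m' => bV.repr ⟨w k, hWV (hwW k)⟩ m', fun j => ?_, fun k => ?_⟩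
    · have h2 := congrArg Subtype.val (bV.sum_repr ⟨y j, hyV j⟩)
      rw [Submodule.coe_sum] at h2
      exact h2.symm.trans (Finset.sum_congr rfl fun m' _ => by rw [Submodule.coe_smul])
    · have h2 := congrArg Subtype.val (bV.sum_repr ⟨w k, hWV (hwW k)⟩)
      rw [Submodule.coe_sum] at h2
      exact h2.symm.trans (Finset.sum_congr rfl fun m' _ => by rw [Submodule.coe_smul])
  clear_value n
  /- the algebraic data -/
  obtain ⟨G, idx₀, ha₀, idx₁, ha₁, hw₀, hw₁⟩ : ∃ (G : AlgGens) (idx₀ : Fin m → Fin d₀ → G.ι),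
      (∀ j i, G.a (idx₀ j i) = (y j).1 i) ∧ ∃ (idx₁ : Fin m → Fin d₁ → G.ι),
      (∀ j l, G.a (idx₁ j l) = cexp ((y j).2 l)) ∧
      (∀ k i, IntPolyBound G.a ((w k).1 i) 1 1) ∧ (∀ k l, IntPolyBound G.a ((w k).2 l) 1 1) := by
    refine ⟨{ ι := (Fin m × Fin d₀) ⊕ (Fin t × Fin d₀) ⊕ (Fin t × Fin d₁) ⊕ (Fin m × Fin d₁),
              a := Sum.elim (fun ji => (y ji.1).1 ji.2) (Sum.elim (fun ki => (w ki.1).1 ki.2)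
                (Sum.elim (fun kl => (w kl.1).2 kl.2) (fun jl => cexp ((y jl.1).2 jl.2)))),
              alg := ?_ }, fun j i => Sum.inl (j, i), fun _ _ => rfl,
      fun j l => Sum.inr (Sum.inr (Sum.inr (j, l))), fun _ _ => rfl,
      fun k i => IntPolyBound.gen (Sum.inr (Sum.inl (k, i))),
      fun k l => IntPolyBound.gen (Sum.inr (Sum.inr (Sum.inl (k, l))))⟩
    rintro (⟨j, i⟩ | ⟨k, i⟩ | ⟨k, l⟩ | ⟨j, l⟩)
    · exact halg₀ j i
    · exact hwalg₀ k i
    · exact hwalg₁ k l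
    · exact halg₁ j l
  /- constants of the data -/
  set c_ζ : ℝ := 1 + ∑ j, ∑ m', ‖ζ j m'‖ with hc_ζ
  set c_ω : ℝ := 1 + ∑ k, ∑ m', ‖om k m'‖ with hc_ω
  set c_v : ℝ := 1 + ∑ m', ‖v m'‖ with hc_v
  clear_value c_ζ c_ω c_v
  have hsumζ : 0 ≤ ∑ j, ∑ m', ‖ζ j m'‖ := by positivity
  have hsumω : 0 ≤ ∑ k, ∑ m', ‖om k m'‖ := by positivity
  have hsumv : 0 ≤ ∑ m', ‖v m'‖ := by positivity
  have hc_ζ1 : 1 ≤ c_ζ := by rw [hc_ζ]; linarith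
  have hc_ω1 : 1 ≤ c_ω := by rw [hc_ω]; linarith
  have hc_v1 : 1 ≤ c_v := by rw [hc_v]; linarith
  have hvA : ∀ i, ∑ m', ‖(v m').1 i‖ ≤ c_v := fun i =>
    calc ∑ m', ‖(v m').1 i‖ ≤ ∑ m', ‖v m'‖ :=
          Finset.sum_le_sum fun m' _ => (norm_le_pi_norm _ i).trans (norm_fst_le _)
      _ ≤ c_v := by rw [hc_v]; linarith
  have hvB : ∀ m' l, ‖(v m').2 l‖ ≤ c_v := fun m' l =>
    calc ‖(v m').2 l‖ ≤ ‖v m'‖ := (norm_le_pi_norm _ l).trans (norm_snd_le _)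
      _ ≤ ∑ m'', ‖v m''‖ := Finset.single_le_sum (f := fun m'' => ‖v m''‖)
          (fun _ _ => norm_nonneg _) (Finset.mem_univ m')
      _ ≤ c_v := by rw [hc_v]; linarith
  have hζle : ∀ j m', ‖ζ j m'‖ ≤ ∑ j', ∑ m'', ‖ζ j' m''‖ := fun j m' =>
    calc ‖ζ j m'‖ ≤ ∑ m'', ‖ζ j m''‖ := Finset.single_le_sum (f := fun m'' => ‖ζ j m''‖)
          (fun _ _ => norm_nonneg _) (Finset.mem_univ m')
      _ ≤ ∑ j', ∑ m'', ‖ζ j' m''‖ := Finset.single_le_sum (f := fun j' => ∑ m'', ‖ζ j' m''‖)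
          (fun _ _ => by positivity) (Finset.mem_univ j)
  have homle : ∀ k m', ‖om k m'‖ ≤ c_ω := fun k m' =>
    calc ‖om k m'‖ ≤ ∑ m'', ‖om k m''‖ := Finset.single_le_sum (f := fun m'' => ‖om k m''‖)
          (fun _ _ => norm_nonneg _) (Finset.mem_univ m')
      _ ≤ ∑ k', ∑ m'', ‖om k' m''‖ := Finset.single_le_sum (f := fun k' => ∑ m'', ‖om k' m''‖)
          (fun _ _ => by positivity) (Finset.mem_univ k)
      _ ≤ c_ω := by rw [hc_ω]; linarith
  /- the constants (all independent of `C` and `S`) -/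
  set A₀ : ℝ := (c_ζ + c_ω) * c_v with hA₀
  set cG : ℝ := A₀ + 1 with hcG
  set cL : ℝ := G.h * ((m + 3) * (Real.log |(G.den : ℝ)| + Real.log G.M) +
    (9 * ((d₀ + d₁ : ℕ) : ℝ) + m + 12)) with hcL
  set cV : ℝ := 8 * ((d₀ + d₁ : ℕ) : ℝ) + 10 + cL + 1 with hcV
  set cs : ℝ := (n + 8) * A₀ + ((d₀ + d₁ : ℕ) : ℝ) + cG + 2 * n + cV + 4 with hcs
  set cdd : ℝ := (d₀ : ℝ) ^ d₀ * (d₁ : ℝ) ^ d₁ with hcdd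
  set C : ℝ := 2 * cdd * (n + 1) * (cs + 5) ^ (n + 1) with hC
  clear_value A₀ cG cL cV cs cdd C
  have hc_v0 : 0 ≤ c_v := zero_le_one.trans hc_v1
  have hA₀1 : 1 ≤ A₀ := by
    rw [hA₀]; exact one_le_mul_of_one_le_of_one_le (by linarith) hc_v1
  have hA₀0 : 0 ≤ A₀ := zero_le_one.trans hA₀1
  have hA₀pos : 0 < A₀ := zero_lt_one.trans_le hA₀1
  have hcG0 : 0 ≤ cG := by rw [hcG]; linarith
  have hlogDn : 0 ≤ Real.log |(G.den : ℝ)| := Real.log_nonneg G.one_le_abs_den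
  have hlogMG : 0 ≤ Real.log G.M := Real.log_nonneg G.one_le_M
  have hcL0 : 0 ≤ cL := by rw [hcL]; positivity
  have hcV0 : 0 ≤ cV := by rw [hcV]; positivity
  have hnA₀ : 0 ≤ (n : ℝ) * A₀ := mul_nonneg (Nat.cast_nonneg _) hA₀0
  have hn0 : (0 : ℝ) ≤ n := Nat.cast_nonneg _
  have hd0 : (0 : ℝ) ≤ ((d₀ + d₁ : ℕ) : ℝ) := Nat.cast_nonneg _
  have hcs_expand : cs = n * A₀ + 8 * A₀ + ((d₀ + d₁ : ℕ) : ℝ) + cG + 2 * n + cV + 4 := by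
    rw [hcs]; ring
  have hcs8 : 8 * A₀ ≤ cs := by rw [hcs_expand]; linarith
  have hcsge : ((d₀ + d₁ : ℕ) : ℝ) + cG + n * A₀ + 2 * n + cV + 4 ≤ cs := by
    rw [hcs_expand]; linarith
  have hcspos : 0 < cs := by rw [hcs_expand]; linarith
  have hcs0 : 0 ≤ cs := hcspos.le
  have hcdd1 : 1 ≤ cdd := by
    have h0 : ∀ k : ℕ, (1 : ℝ) ≤ (k : ℝ) ^ k := fun k => by
      rcases Nat.eq_zero_or_pos k with hk | hk
      · subst hk; simp
      · exact one_le_pow₀ (by exact_mod_cast hk)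
    rw [hcdd]; exact one_le_mul_of_one_le_of_one_le (h0 d₀) (h0 d₁)
  have hcddpos : 0 < cdd := lt_of_lt_of_le zero_lt_one hcdd1
  have hC1 : 1 ≤ C := by
    rw [hC]
    have h1 : (1 : ℝ) ≤ (cs + 5) ^ (n + 1) := one_le_pow₀ (by linarith)
    have h2 : (1 : ℝ) ≤ (n + 1) := by linarith
    have h3 : (1 : ℝ) ≤ 2 * cdd := by linarith
    exact one_le_mul_of_one_le_of_one_le (one_le_mul_of_one_le_of_one_le h3 h2) h1
  /- `S₀` -/
  have hev : ∀ᶠ S : ℕ in Filter.atTop, 3 ≤ S ∧ Real.log C ≤ Real.log (S : ℝ) ∧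
      1 * Real.log (S : ℝ) ^ (2 * (d₀ + d₁)) ≤ S :=
    (Filter.eventually_ge_atTop 3).and
      (((Real.tendsto_log_atTop.comp tendsto_natCast_atTop_atTop).eventually_ge_atTop _).and
        (eventually_mul_log_pow_le 1 (2 * (d₀ + d₁))))
  obtain ⟨S₀, hS₀⟩ := Filter.eventually_atTop.1 hev
  refine ⟨C, S₀, hC1, fun S hS => ?_⟩
  obtain ⟨hS3, hlogC, hlogpow⟩ := hS₀ S hS
  rw [one_mul] at hlogpow
  obtain ⟨hL1, hΔpos, hΔB, hL2, hlogΔ⟩ := auxDelta_facts hC1 hV hS3 hlogpow hlogC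
  set L : ℝ := Real.log S with hL
  set Δ : ℝ := auxDelta C d₀ d₁ n S with hΔ
  clear_value L Δ
  have hLpos : 0 < L := by linarith
  have hΔ0 : 0 ≤ Δ := hΔpos.le
  have hΔ1 : 1 ≤ Δ := (one_le_pow₀ hL1).trans hL2
  have hSpos : (0 : ℝ) < S := by exact_mod_cast (show 0 < S by omega)
  have hS1 : (1 : ℝ) ≤ S := by exact_mod_cast (show 1 ≤ S by omega)
  have hS1n : 1 ≤ S := by omega
  have hΔL1 : 1 ≤ Δ / L := by
    have h1 : L * 1 ≤ L * L := mul_le_mul_of_nonneg_left hL1 hLpos.le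
    have h2 : L ^ 2 = L * L := sq L
    rw [le_div_iff₀ hLpos]; linarith
  have hΔLle : Δ / L ≤ Δ := div_le_self hΔ0 hL1
  have hΔL2le : Δ / L ^ 2 ≤ Δ := div_le_self hΔ0 (one_le_pow₀ hL1)
  have hΔSle : Δ / S ≤ Δ := div_le_self hΔ0 hS1
  /- the parameters -/
  set T : ℕ := ⌈Δ / L⌉₊ with hT
  set E₀ : ℕ := ⌊Δ / L ^ 2 / d₀⌋₊ + 1 with hE₀
  set E₁ : ℕ := ⌊Δ / S / d₁⌋₊ + 1 with hE₁
  set R : ℝ := c_ζ * S + c_ω with hR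
  set Ttr : ℕ := ⌈cs * Δ⌉₊ with hTtr
  set kb : ℕ := ⌈Real.exp (((n + 1) * (cs + 4)) * Δ)⌉₊ with hkb
  set Pb : ℕ := ⌊Real.exp Δ⌋₊ with hPb
  clear_value T E₀ E₁ R Ttr kb Pb
  -- `T`
  have hTle : (T : ℝ) ≤ 2 * Δ / L := by
    have h1 := (Nat.ceil_lt_add_one (zero_le_one.trans hΔL1)).le
    rw [← hT] at h1
    calc (T : ℝ) ≤ Δ / L + 1 := h1
      _ ≤ Δ / L + Δ / L := by linarith
      _ = 2 * Δ / L := by ring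
  have hT2Δ : (T : ℝ) ≤ 2 * Δ := by
    have h1 : 2 * Δ * 1 ≤ 2 * Δ * L := mul_le_mul_of_nonneg_left hL1 (by linarith)
    exact hTle.trans (by rw [div_le_iff₀ hLpos]; linarith)
  -- `E₀`, `E₁`, `A = d₀(E₀-1)`, `B = d₁(E₁-1)`
  have hE₀ge : Δ / L ^ 2 / d₀ ≤ E₀ := by
    rw [hE₀]; push_cast; exact (Nat.lt_floor_add_one _).le
  have hE₁ge : Δ / S / d₁ ≤ E₁ := by
    rw [hE₁]; push_cast; exact (Nat.lt_floor_add_one _).le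
  have hE₀le : (E₀ : ℝ) ≤ Real.exp Δ := by
    have h1 : (⌊Δ / L ^ 2 / d₀⌋₊ : ℝ) ≤ Δ / L ^ 2 / d₀ :=
      Nat.floor_le (div_nonneg (div_nonneg hΔ0 (pow_nonneg hLpos.le 2)) (Nat.cast_nonneg _))
    have h2 : Δ / L ^ 2 / d₀ ≤ Δ :=
      (div_nat_le_self_of_nonnneg (div_nonneg hΔ0 (pow_nonneg hLpos.le 2)) d₀).trans hΔL2le
    have h3 := Real.add_one_le_exp Δ
    rw [hE₀]; push_cast; linarith
  have hE₁le : (E₁ : ℝ) ≤ Real.exp Δ := by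
    have h1 : (⌊Δ / S / d₁⌋₊ : ℝ) ≤ Δ / S / d₁ :=
      Nat.floor_le (div_nonneg (div_nonneg hΔ0 hSpos.le) (Nat.cast_nonneg _))
    have h2 : Δ / S / d₁ ≤ Δ :=
      (div_nat_le_self_of_nonnneg (div_nonneg hΔ0 hSpos.le) d₁).trans hΔSle
    have h3 := Real.add_one_le_exp Δ
    rw [hE₁]; push_cast; linarith
  have hA : ((d₀ * (E₀ - 1) : ℕ) : ℝ) ≤ Δ / L ^ 2 := by
    rw [hE₀, Nat.add_sub_cancel]; exact natMul_floor_div_le (by positivity) d₀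
  have hB : ((d₁ * (E₁ - 1) : ℕ) : ℝ) ≤ Δ / S := by
    rw [hE₁, Nat.add_sub_cancel]; exact natMul_floor_div_le (by positivity) d₁
  have hAΔ : ((d₀ * (E₀ - 1) : ℕ) : ℝ) ≤ Δ := hA.trans hΔL2le
  have hBΔ : ((d₁ * (E₁ - 1) : ℕ) : ℝ) ≤ Δ := hB.trans hΔSle
  -- `U = #Λ`
  have hU1 : 1 ≤ E₀ ^ d₀ * E₁ ^ d₁ :=
    Nat.one_le_iff_ne_zero.2 (Nat.mul_ne_zero (pow_ne_zero _ (by rw [hE₀]; omega))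
      (pow_ne_zero _ (by rw [hE₁]; omega)))
  have hU1r : (1 : ℝ) ≤ ((E₀ ^ d₀ * E₁ ^ d₁ : ℕ) : ℝ) := by exact_mod_cast hU1
  have hUle : ((E₀ ^ d₀ * E₁ ^ d₁ : ℕ) : ℝ) ≤ Real.exp (((d₀ + d₁ : ℕ) : ℝ) * Δ) := by
    push_cast
    have h0 := pow_le_pow_left₀ (Nat.cast_nonneg E₀) hE₀le d₀
    have h1 := pow_le_pow_left₀ (Nat.cast_nonneg E₁) hE₁le d₁
    rw [← Real.exp_nat_mul] at h0 h1
    calc (E₀ : ℝ) ^ d₀ * (E₁ : ℝ) ^ d₁ ≤ Real.exp (d₀ * Δ) * Real.exp (d₁ * Δ) :=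
          mul_le_mul h0 h1 (by positivity) (by positivity)
      _ = Real.exp ((d₀ + d₁ : ℝ) * Δ) := by rw [← Real.exp_add]; ring_nf
  have hUlow : C * Δ ^ n ≤ cdd * ((E₀ ^ d₀ * E₁ ^ d₁ : ℕ) : ℝ) := by
    have := C_mul_pow_le_card hV.le hΔ0 hLpos hSpos hΔB hE₀ge hE₁ge
    push_cast; rw [hcdd]; exact this
  -- `R`, `G₀`, `ρ`
  have hc_ζS : 0 ≤ c_ζ * S := mul_nonneg (by linarith) hSpos.le
  have hR1 : 1 ≤ R := by rw [hR]; linarith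
  have hR0 : 0 ≤ R := zero_le_one.trans hR1
  have hRcv : R * c_v ≤ A₀ * S := by
    rw [hA₀, hR]
    have h1 : c_ω ≤ c_ω * S := le_mul_of_one_le_right (by linarith) hS1
    have h2 : c_ω * c_v ≤ c_ω * S * c_v := mul_le_mul_of_nonneg_right h1 hc_v0
    have h3 : (c_ζ * S + c_ω) * c_v = c_ζ * c_v * S + c_ω * c_v := by ring
    have h4 : (c_ζ + c_ω) * c_v * S = c_ζ * c_v * S + c_ω * S * c_v := by ring
    rw [h3, h4]; linarith
  have hRcv1 : 1 ≤ R * c_v := one_le_mul_of_one_le_of_one_le hR1 hc_v1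
  have hG1 : (1 : ℝ) ≤ (R * c_v) ^ (d₀ * (E₀ - 1)) := one_le_pow₀ hRcv1
  have hG0le : (R * c_v) ^ (d₀ * (E₀ - 1)) ≤ Real.exp (cG * Δ) := by
    have hAS : 0 < A₀ * S := mul_pos hA₀pos hSpos
    have hlogA : Real.log A₀ ≤ A₀ := (Real.log_le_sub_one_of_pos hA₀pos).trans (by linarith)
    have hlogA0 : 0 ≤ Real.log A₀ := Real.log_nonneg hA₀1
    have hΔL2 : 0 ≤ Δ / L ^ 2 := div_nonneg hΔ0 (pow_nonneg hLpos.le 2)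
    calc (R * c_v) ^ (d₀ * (E₀ - 1)) ≤ (A₀ * S) ^ (d₀ * (E₀ - 1)) :=
          pow_le_pow_left₀ (mul_nonneg hR0 hc_v0) hRcv _
      _ = Real.exp ((d₀ * (E₀ - 1) : ℕ) * (Real.log A₀ + L)) := by
          rw [← Real.exp_log hAS, ← Real.exp_nat_mul, Real.log_mul hA₀pos.ne' hSpos.ne', hL]
      _ ≤ Real.exp (cG * Δ) := by
          rw [Real.exp_le_exp, hcG]
          calc ((d₀ * (E₀ - 1) : ℕ) : ℝ) * (Real.log A₀ + L) ≤ Δ / L ^ 2 * (A₀ + L) :=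
                mul_le_mul hA (by linarith) (by linarith) hΔL2
            _ = A₀ * (Δ / L ^ 2) + Δ / L := by field_simp
            _ ≤ A₀ * Δ + Δ := add_le_add (mul_le_mul_of_nonneg_left hΔL2le hA₀0) hΔLle
            _ = (A₀ + 1) * Δ := by ring
  have hρ0 : 0 ≤ R * ((d₁ * (E₁ - 1) : ℕ) : ℝ) * c_v :=
    mul_nonneg (mul_nonneg hR0 (Nat.cast_nonneg _)) hc_v0
  have hρ : R * ((d₁ * (E₁ - 1) : ℕ) : ℝ) * c_v ≤ A₀ * Δ := by
    calc R * ((d₁ * (E₁ - 1) : ℕ) : ℝ) * c_v = (R * c_v) * ((d₁ * (E₁ - 1) : ℕ) : ℝ) := by ring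
      _ ≤ (A₀ * S) * (Δ / S) := mul_le_mul hRcv hB (Nat.cast_nonneg _) (mul_nonneg hA₀0 hSpos.le)
      _ = A₀ * Δ := by field_simp
  -- `Ttr`, `kb`, `Pb`
  have hTtrge : cs * Δ ≤ Ttr := by rw [hTtr]; exact Nat.le_ceil _
  have hT8 : 8 * (R * ((d₁ * (E₁ - 1) : ℕ) : ℝ) * c_v) ≤ Ttr := by
    calc 8 * (R * ((d₁ * (E₁ - 1) : ℕ) : ℝ) * c_v) ≤ 8 * (A₀ * Δ) := by linarith
      _ = 8 * A₀ * Δ := by ring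
      _ ≤ cs * Δ := mul_le_mul_of_nonneg_right hcs8 hΔ0
      _ ≤ Ttr := hTtrge
  have hTtr1 : 1 ≤ Ttr := by
    rw [hTtr]; exact Nat.one_le_ceil_iff.2 (mul_pos hcspos hΔpos)
  have hTtrle : (Ttr : ℝ) ≤ cs * Δ + Δ := by
    have := (Nat.ceil_lt_add_one (mul_nonneg hcs0 hΔ0)).le
    rw [← hTtr] at this; linarith
  have hkbge : Real.exp (((n + 1) * (cs + 4)) * Δ) ≤ kb := by rw [hkb]; exact Nat.le_ceil _
  have hkb0 : 0 < kb := by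
    rw [hkb]; exact Nat.lt_ceil.2 (by simpa using Real.exp_pos _)
  have hkble : (kb : ℝ) ≤ Real.exp (((n + 1) * (cs + 5)) * Δ) := by
    have h1 := (Nat.ceil_lt_add_one (Real.exp_nonneg (((n + 1) * (cs + 4)) * Δ))).le
    rw [← hkb] at h1
    refine h1.trans ?_
    have h2 : Real.exp (((n + 1) * (cs + 4)) * Δ) + 1 ≤ Real.exp (((n + 1) * (cs + 4)) * Δ + 1) := by
      rw [Real.exp_add]
      have he : (2 : ℝ) ≤ Real.exp 1 := by have := Real.add_one_le_exp (1 : ℝ); linarith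
      have h3 : 1 ≤ Real.exp (((n + 1) * (cs + 4)) * Δ) := Real.one_le_exp (by positivity)
      have h4 := mul_le_mul_of_nonneg_left he (Real.exp_nonneg (((n + 1) * (cs + 4)) * Δ))
      linarith
    refine h2.trans (Real.exp_le_exp.2 ?_)
    have h5 : (0 : ℝ) ≤ n * Δ := mul_nonneg (Nat.cast_nonneg _) hΔ0
    have h6 : ((n : ℝ) + 1) * (cs + 5) * Δ = ((n : ℝ) + 1) * (cs + 4) * Δ + (n * Δ + Δ) := by ring
    rw [h6]; linarith
  have hPble : (Pb : ℝ) ≤ Real.exp Δ := by rw [hPb]; exact Nat.floor_le (Real.exp_nonneg _)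
  have hPb1 : 1 ≤ Pb := by
    rw [hPb]; exact Nat.le_floor (by simpa using Real.one_le_exp hΔ0)
  have hPblt : Real.exp Δ < Pb + 1 := by
    rw [hPb]; exact_mod_cast Nat.lt_floor_add_one (Real.exp Δ)
  -- `N = A + 1 + Ttr`
  have hN : ((d₀ * (E₀ - 1) + 1 + Ttr : ℕ) : ℝ) ≤ (cs + 3) * Δ := by
    rw [Nat.cast_add, Nat.cast_add, Nat.cast_one]
    have h1 : (cs + 3) * Δ = cs * Δ + Δ + Δ + Δ := by ring
    rw [h1]; linarith
  -- the count
  have hcard : kb ^ (2 * (d₀ * (E₀ - 1) + 1 + Ttr) ^ n) < (Pb + 1) ^ (E₀ ^ d₀ * E₁ ^ d₁) :=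
    count_lt hΔ1 hcs0 hkble hkb0 hN hPblt hUlow hcddpos (by omega) (by rw [hC])
  /- the auxiliary polynomial -/
  obtain ⟨p, hp0, hpb, hsmall⟩ := exists_auxP_small v (E₀ := E₀) (E₁ := E₁) hR1 hc_v1 hvA hvB
    Ttr Pb kb hT8 hTtr1 hkb0 hcard
  have hε := eps_le_exp_neg (n := n) (N := d₀ * (E₀ - 1) + 1 + Ttr)
    (U := ((E₀ ^ d₀ * E₁ ^ d₁ : ℕ) : ℝ)) (G₀ := (R * c_v) ^ (d₀ * (E₀ - 1)))
    (ρ := R * ((d₁ * (E₁ - 1) : ℕ) : ℝ) * c_v) hΔ1 hU1r hUle hG1 hG0le hρ0 hρ hPb1 hPble hTtrge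
    hkbge hN (by positivity) hcG0 hA₀0 hcV0 hcsge
  have hsmall' : ∀ ξ : Fin n → ℂ, (∀ m', ‖ξ m'‖ ≤ R) →
      ‖evalAt (auxP p) (exp (∑ m', ξ m' • v m'))‖ ≤ Real.exp (-cV * Δ) :=
    fun ξ hξ => (hsmall ξ hξ).trans hε
  refine ⟨auxP p, T, auxP_ne_zero hp0, by rw [hT]; exact Nat.le_ceil _,
    (Nat.cast_le.2 (degX_auxP_le p)).trans hA, (Nat.cast_le.2 (degY_auxP_le p)).trans hB,
    fun h hh => ?_⟩
  /- vanishing at `exp_G(y_h)` along `W` -/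
  -- `y_h` in the coordinates `v`
  set ξ₀ : Fin n → ℂ := fun m' => ∑ j, ((h j : ℤ) : ℂ) * ζ j m' with hξ₀
  clear_value ξ₀
  have hlatt : latt y (fun j => (h j : ℤ)) = ∑ m', ξ₀ m' • v m' := by
    rw [latt_apply]
    calc ∑ j, (h j : ℤ) • y j = ∑ j, ∑ m', (((h j : ℤ) : ℂ) * ζ j m') • v m' := by
          refine Finset.sum_congr rfl fun j _ => ?_
          rw [hy_repr j, Finset.smul_sum]
          refine Finset.sum_congr rfl fun m' _ => ?_
          rw [← smul_smul, Int.cast_smul_eq_zsmul]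
      _ = ∑ m', ξ₀ m' • v m' := by
          rw [Finset.sum_comm]
          exact Finset.sum_congr rfl fun m' _ => by rw [hξ₀, Finset.sum_smul]
  have hξ₀le : ∀ m', ‖ξ₀ m'‖ ≤ c_ζ * S := by
    intro m'
    rw [hξ₀]
    calc ‖∑ j, ((h j : ℤ) : ℂ) * ζ j m'‖ ≤ ∑ j, ‖((h j : ℤ) : ℂ) * ζ j m'‖ := norm_sum_le _ _
      _ ≤ ∑ j, (S : ℝ) * ‖ζ j m'‖ := Finset.sum_le_sum fun j _ => by
          rw [norm_mul]
          refine mul_le_mul_of_nonneg_right ?_ (norm_nonneg _)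
          rw [Int.cast_natCast, Complex.norm_natCast]; exact_mod_cast hh j
      _ = S * ∑ j, ‖ζ j m'‖ := by rw [Finset.mul_sum]
      _ ≤ S * ∑ j, ∑ m'', ‖ζ j m''‖ := mul_le_mul_of_nonneg_left (Finset.sum_le_sum fun j _ =>
          Finset.single_le_sum (f := fun m'' => ‖ζ j m''‖) (fun _ _ => norm_nonneg _)
            (Finset.mem_univ m')) hSpos.le
      _ ≤ c_ζ * S := by
          rw [hc_ζ, add_mul, one_mul, mul_comm]
          linarith
  refine vanishesToOrder_auxP_of_small G y idx₀ ha₀ idx₁ ha₁ w hw₀ hw₁ W hWspan p hpb h hh T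
    fun k hk κ => ?_
  -- the word bound
  have hword := norm_wordDeriv_le_of_small (auxP p) v (R := R) (R₀ := c_ζ * S) (c_om := c_ω)
    (ε := Real.exp (-cV * Δ)) (by linarith) ξ₀ hξ₀le om homle (by rw [hR]) hsmall' κ
  have e1 : (fun i => ∑ m', om (κ i) m' • v m') = fun i => w (κ i) :=
    funext fun i => (hw_repr (κ i)).symm
  rw [e1, ← hlatt] at hword
  -- numerics
  have hkT : k ≤ T := hk.le
  have hfact := factorial_mul_le_exp (d := d₀ + d₁) hL1 hΔ1 hkT hTle hlogΔ
  have hcardΛ : (Fintype.card ((Fin d₀ → Fin E₀) × (Fin d₁ → Fin E₁)) : ℝ) =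
      ((E₀ ^ d₀ * E₁ ^ d₁ : ℕ) : ℝ) := by
    simp [Fintype.card_prod, Fintype.card_fin]
  have hlen := length_le_exp (k := k) (T := T) (A := d₀ * (E₀ - 1)) (B := d₁ * (E₁ - 1)) (m := m)
    (S := S) (d := d₀ + d₁) (U := (Fintype.card ((Fin d₀ → Fin E₀) × (Fin d₁ → Fin E₁)) : ℝ))
    (Pb := Pb) hL1 hΔ1 hL.symm hS1n hkT hTle hlogΔ hA hBΔ (Nat.cast_nonneg _)
    (by rw [hcardΛ]; exact hUle) hPble
  have he : ((d₀ * (E₀ - 1) * 1 + d₁ * (E₁ - 1) * (m * S) + k : ℕ) : ℝ) ≤ (m + 3) * Δ := by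
    have h1 : ((d₁ * (E₁ - 1) : ℕ) : ℝ) * ((m * S : ℕ) : ℝ) ≤ m * Δ := by
      calc ((d₁ * (E₁ - 1) : ℕ) : ℝ) * ((m * S : ℕ) : ℝ) ≤ Δ / S * ((m * S : ℕ) : ℝ) :=
            mul_le_mul_of_nonneg_right hB (Nat.cast_nonneg _)
        _ = m * Δ := by push_cast; field_simp
    have h2 : (k : ℝ) ≤ 2 * Δ := le_trans (by exact_mod_cast hkT) hT2Δ
    push_cast at hAΔ h1 ⊢
    linarith
  have hthr := exp_neg_le_threshold (hG := G.h) (c := 9 * ((d₀ + d₁ : ℕ) : ℝ) + m + 12)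
    G.one_le_abs_den G.one_le_M he
    (lt_of_lt_of_le zero_lt_one (le_max_left _ _))
    (max_le (Real.one_le_exp (by positivity)) hlen)
  rw [← hcL] at hthr
  rw [norm_mul, Complex.norm_natCast]
  have hmid : (k.factorial : ℝ) * ‖evalAt (wordDeriv (fun i => w (κ i)) (auxP p))
      (exp (latt y fun j => (h j : ℤ)))‖ ≤ Real.exp (-(cL + 1) * Δ) :=
    calc (k.factorial : ℝ) * ‖evalAt (wordDeriv (fun i => w (κ i)) (auxP p))
          (exp (latt y fun j => (h j : ℤ)))‖
        ≤ (k.factorial : ℝ) * (2 ^ k * (k : ℝ) ^ k * Real.exp (-cV * Δ)) :=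
          mul_le_mul_of_nonneg_left hword (Nat.cast_nonneg _)
      _ = ((k.factorial : ℝ) * 2 ^ k * (k : ℝ) ^ k) * Real.exp (-cV * Δ) := by ring
      _ ≤ Real.exp ((8 * ((d₀ + d₁ : ℕ) : ℝ) + 10) * Δ) * Real.exp (-cV * Δ) :=
          mul_le_mul_of_nonneg_right hfact (Real.exp_nonneg _)
      _ = Real.exp (-(cL + 1) * Δ) := by rw [← Real.exp_add, hcV]; ring_nf
  have hlt : Real.exp (-(cL + 1) * Δ) < Real.exp (-cL * Δ) := by
    rw [Real.exp_lt_exp]; nlinarith [hΔpos]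
  exact hmid.trans_lt (hlt.trans_le hthr)

end Main

end LinGroup

end Literature.NumberTheory.Transcendental
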